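import Literature.AlgebraicGeometry.HodgeTheory.ComplexTorusHodgeGeneralHodgeEndomorphismAlgebraBlocks
import Literature.AlgebraicGeometry.HodgeTheory.ComplexTorusIntegralHodgeClassesLefschetzDecompositionMotivicPiecesHardLefschetz
import HarnessLib

/-!
# Hodge-general polarized complex tori ABOVE THE MIDDLE DIMENSION: `End_Hdg(H^{2g−s}(X, ℚ)) = ⊕ᵢ ℚ ε′_{s,i} ≅ ℚ^{⌊s/2⌋+1}`, its blocks and primitive idempotents are Künnemann's
# transposed projectors `ε′_{s,i}`, and for EVERY weight `s ≤ 2g` the `ℚ`-Hodge structure `Hˢ(X, ℚ)` has exactly one decomposition into indecomposable sub-Hodge structures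

Layer `Literature/AlgebraicGeometry/HodgeTheory`, namespace `Literature.AlgebraicGeometry.HodgeTheory.ComplexTorusCat`; lane `lit-hodgefound` (Track 2 foundations
library), prover seat `lit-hodgefound-p35` (gen 46, row g46-#5). THEOREMS ONLY (no definition, no named fact, net debt 0).

✔ g46-#1 §4 / ✔ g46-#4 treated the weights `s ≤ g`: `End_Hdg(Hˢ(X, ℚ)) = ⊕ᵢ ℚ ε_{s,i}` for `Hg(X) = Sp(V, θ)`, blocks = primitive idempotents = `{ε_{s,i}}ᵢ`, unique indecomposable decomposition.
Above the middle, ✔ g45-#1/#6 realised the transposed projectors `e′_{s,i} = ᵗe_{s,i}` (✔ g44-#2) as a complete orthogonal family `ε′_{s,i}` of idempotents of `End_Hdg(H^{2g−s}(X, ℚ))`,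
`s + t = 2g`, with `Im ε′_{s,i} = L^{g−s+i} H^{s−2i}(X, ℚ)_prim` (✔ g45-#2). THIS FILE repeats the two steps for `t = 2g − s ≥ g`:

* §1 (towers from a non-degenerate `Θ ∈ NS(X)` with `Θ^{[g]} = D·[pt]`, `N_s ≠ 0`, complete towers `s = s₀ + 2k ≤ g`, `s₀ ≤ 1`, `s + t = 2g`): `ε′_{s,i} ≠ 0`, `(ε′_{s,i})ᵢ` and `(e′_{s,i})ᵢ` are
  `ℚ`-linearly independent; **`Hg = Sp` ⟹ every Hodge endomorphism of `H^{2g−s}(X, ℚ)` is `Σᵢ cᵢ ε′_{s,i}`** (on the underlying linear maps; the `e′_{s,i}` are `k + 1` independent members of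
  p08's corner subspace `π_t ∘ Bᵍ(X × X)` of dimension `dim End_Hdg(Hᵗ(X, ℚ)) = ⌊min(t, 2g−t)/2⌋ + 1 = k + 1`, ✔ g45-#7) and **`End_Hdg(H^{2g−s}(X, ℚ)) ≅ ℚ^{k+1}` AS `ℚ`-ALGEBRAS**.
* §2 **`Hg = Sp` ⟹ the blocks and the primitive idempotents of `End_Hdg(H^{2g−s}(X, ℚ))` are exactly the `ε′_{s,i}`** (`⌊s/2⌋ + 1` of them), every idempotent is a unique partial sum
  (`2^{⌊s/2⌋+1}` of them), **the decomposition of `H^{2g−s}(X, ℚ)` into indecomposable sub-`ℚ`-Hodge structures is unique** (`= {ε′_{s,i}}ᵢ`, i.e. `⊕ᵢ L^{g−s+i} H^{s−2i}(X, ℚ)_prim`) — ✔ g46-#4's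
  §0 `Subalgebra` wrappers of Lam's (22.1).
* §3 polarized type `(d₁, …, d_g)`; §4 frame-free, ALL WEIGHTS `s ≤ 2g` of a complex torus of positive dimension `g` with a Riemann form `θ` and `Hg(X) = Sp(V, θ)`:
  `End_Hdg(Hˢ(X, ℚ)) ≅ ℚ^{⌊min(s, 2g−s)/2⌋+1}` as `ℚ`-algebras, `#{blocks} = #{primitive idempotents} = ⌊min(s, 2g−s)/2⌋ + 1`, `#{idempotents} = 2^{⌊min(s, 2g−s)/2⌋+1}`, and
  **`Hˢ(X, ℚ)` has exactly one decomposition into indecomposable sub-Hodge structures** (below the middle ✔ g46-#4, above §3).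

## The sources, verbatim (held texts, re-read for this row)

* H. Lange, *Abelian Varieties over the Complex Numbers* (Springer 2023), held `book:lange1992-complex-abelian-varieties`, §7.3.2 (1)–(3) (p0338 L3–L16) ("pairwise non-isomorphic irreducible
  `Sp_{2g}(ℚ)`-representations"), §7.2.2 Thm. 7.2.4 (p0331), §6.3.4 Prop. 6.3.10 (p0318 L47) (`ᵗπ_i = π_{2g−i}`).
* T. Y. Lam, *A First Course in Noncommutative Rings* (2nd ed. 2001), held `book:lamnd-first-course-noncommutative-rings`, p0325 L9–L13 ((22.1)) and L24 ("(centrally) primitive idempotents"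
  of `ℚ × ℚ × ⋯`); §21 (21.1)–(21.3), Prop. (21.8).
* B. Kahn, *Zeta and L-Functions of Varieties and Motives* (CUP 2020), §3.5.2 Prop. 3.45, §6.6 Thm. 6.19 (p0121 L4–L12) (duality `h(X)^∨ = h(X)(g)`), App. A Thm. A.6 (p0135).
* R. Goodman, N. R. Wallach, *Symmetry, Representations, and Invariants* (GTM 255, 2009), §5.5.1 Cor. 5.5.9 (5.54) (`End_{Sp}(⋀V)` multiplicity-free).
* J. S. Milne, *Lefschetz classes on abelian varieties*, Duke Math. J. 96 (1999), §5 p. 664 (p0026 L40–L50), Thm. 5.9.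
* K. Künnemann, *A Lefschetz decomposition for Chow motives of abelian schemes*, Invent. Math. 113 (1993) — not held; through Milne §5 and Murre §7.18.

## References
* [Lange2023AbelianVarietiesComplex] H. Lange, Abelian Varieties over the Complex Numbers, Springer 2023 — §7.3.2 (1)–(3) (p0338), §7.2.2 Thm. 7.2.4 (p0331), §6.3.4 Prop. 6.3.10 (p0318), §3.6 Thm. 3.6.1.
* [Lam2001FirstCourse] T. Y. Lam, A First Course in Noncommutative Rings, 2nd ed., Springer GTM 131, 2001 — §22 Prop. (22.1), p. 325; §21 (21.1)–(21.3), Prop. (21.8).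
* [Kahn2020] B. Kahn, Zeta and L-Functions of Varieties and Motives, LMS LN 462, CUP 2020 — §3.5.2 Prop. 3.45, §6.6 Thm. 6.19, App. A Thm. A.6 (p0135).
* [GoodmanWallachGTM255] R. Goodman, N. R. Wallach, Symmetry, Representations, and Invariants, GTM 255, Springer 2009 — §5.5.1 Cor. 5.5.9 (5.54).
* [Milne1999LefschetzClasses] J. S. Milne, Lefschetz classes on abelian varieties, Duke Math. J. 96 (1999) — §5 p. 664 (p0026 L40–L50), Thm. 5.9.
* [Kunnemann1993] K. Künnemann, A Lefschetz decomposition for Chow motives of abelian schemes, Invent. Math. 113 (1993) 85–102 (not held; through Milne §5 and Murre §7.18).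
-/

noncomputable section

open CategoryTheory Function Module

namespace Literature.AlgebraicGeometry.HodgeTheory

open Literature.AlgebraicGeometry.Motives Literature.AlgebraicGeometry.Motives.HodgeStructure
open Literature.Geometry.Kaehler Literature.Geometry.Kaehler.ComplexTorus
open Literature.RingTheory.Idempotents

namespace ComplexTorusCat

/-- `dim_ℂ E = g` from a frame `Fin (2g) ≃ ι` of the lattice. [cite: Lange2023AbelianVarietiesComplex, §1.1.2 (p0021 L5)] -/
private theorem finrank_eq₆₄ (X : ComplexTorusCat) {gX : ℕ} (eX : Fin (2 * gX) ≃ X.toIsog.ι) : finrank ℂ X.toIsog.E = gX := by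
  have h := finrank_complex_mul_two X.toIsog.Φ eX
  omega

/-! ## §1 Above the middle: `ε′_{s,i} ≠ 0`, linear independence, `Hg = Sp` ⟹ `End_Hdg(H^{2g−s}(X, ℚ)) = ⊕ᵢ ℚ ε′_{s,i} ≅ ℚ^{k+1}` -/

section Kunnemann

variable (X : ComplexTorusCat) {gX gXX gT : ℕ} (hTX : gXX + gX = gT) (eX : Fin (2 * gX) ≃ X.toIsog.ι) (eXX : Fin (2 * gXX) ≃ (prodObj X X).toIsog.ι)
  (eT : Fin (2 * gT) ≃ (prodObj X (prodObj X X)).toIsog.ι) (hX0 : 2 * gX + 2 * 0 = 2 * gX) (hgX : gX + gX = 2 * gX) (hcX : 2 * gX + 2 * gX = 2 * gXX)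
  (hgXX : gXX + gXX = 2 * gXX) (hgg₂ : gX + gX = gXX) (hN' : 2 * gX + 2 * gXX = 2 * gT) (hgT : gT + gT = 2 * gT)
  (f : Fin (gX + gX) ≃ X.toIsog.ι) (hf : orientationSign X.toIsog.Φ f = 1) (f' : Fin ((gX + gX) + (gX + gX)) ≃ X.toIsog.ι ⊕ X.toIsog.ι)
  (Θ : neronSeveriGroup X.toIsog.Φ) (D : ℤ) {c₁ bc m₂ d₂ l₁ l₇ l₉ : ℕ} (hbc₁ : bc + 1 = gXX)
  (hl₁ : l₁ + 2 * 1 = 2 * gX) (hl₁' : l₁ + 2 * c₁ = 2 * gXX) (h7 : l₇ + 2 * bc = 2 * gT) (h7' : l₇ + 2 * m₂ = 2 * gXX) (hmX : m₂ + gX = bc)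
  (hΛL : m₂ + c₁ = d₂) (h9 : l₉ + 2 * d₂ = 2 * gT) (h9' : l₉ + 2 * gX = 2 * gXX)
  (hnd : ∀ v : X.toIsog.E, v ≠ 0 → ∃ w : X.toIsog.E, (Θ : X.toIsog.E [⋀^Fin 2]→L[ℝ] ℝ) ![v, w] ≠ 0)
  {θ : neronSeveriGroup X.toIsog.Φ} (hθ : IsRiemannForm X.toIsog.Φ (θ : X.toIsog.E [⋀^Fin 2]→L[ℝ] ℝ))

-- `↥End_Hdg ⊂ End_ℚ(↥Hᵗ(X, ℚ))` is several coercions deep (as in ✔ g45-#1, ✔ g46-#1/#4)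
set_option maxSynthPendingDepth 3
set_option synthInstance.maxHeartbeats 200000

include hnd in
/-- **`ε′_{s,i} ≠ 0` in `End_Hdg(H^{2g−s}(X, ℚ))`** (`s = s₀ + 2k ≤ g`, `N_s ≠ 0`; `i < k` or `s₀ ≤ 1`): `e′_{s,i} ≠ 0` (✔ g44-#2) and `hodgeCornerEquiv` is injective. [cite: Lange2023AbelianVarietiesComplex, §6.3.4 Prop. 6.3.10 (p0318)]
[cite: Milne1999LefschetzClasses, §5 p. 664 (p0026 L42–L50)] [cite: Kunnemann1993] -/
theorem hodgeCornerEquiv_inv_smul_integralHodgeClassesCorrRingHom_pushforward_swapHom_lefschetzFamily_ne_zero (hΘ : nsDivPower X Θ gX = D • pointIntegralHodgeClass X eX) (s₀ k : ℕ) (hk : s₀ + 2 * k ≤ gX + 1) (hs : s₀ + 2 * k ≤ gX)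
    (hN : lefschetzFamilyConstant gX D s₀ k ≠ 0) {t : ℕ} (hst : (s₀ + 2 * k) + t = gX + gX) (ht : t ≤ gX + gX) (i : Fin (k + 1))
    (hi : (i : ℕ) < k ∨ s₀ ≤ 1) : CorrRing.hodgeCornerEquiv X.toIsog.Φ f hf f' ⟨t, Nat.lt_succ_of_le ht⟩
        ⟨_, inv_smul_integralHodgeClassesCorrRingHom_pushforward_swapHom_lefschetzFamily_mem_corner X hTX eX eXX eT hX0 hgX hcX hgXX hgg₂ hN' hgT f hf f' Θ D hbc₁ hl₁ hl₁' h7 h7' hmX hΛL h9 h9' hΘ s₀ k hk hst i⟩ ≠ 0 := by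
  rw [(CorrRing.hodgeCornerEquiv X.toIsog.Φ f hf f' ⟨t, Nat.lt_succ_of_le ht⟩).map_ne_zero_iff, MatrixUnits.ne_zero_iff (CorrRing.isIdempotentElem_hodgeKunnethIdem X.toIsog.Φ f hf f' _)]
  intro h0
  exact inv_smul_integralHodgeClassesCorrRingHom_pushforward_swapHom_lefschetzFamily_ne_zero X hTX eX eXX eT hX0 hgX hcX hgXX hgg₂ hN' hgT f hf f' Θ D hbc₁ hl₁ hl₁' h7 h7' hmX hΛL h9 h9' hnd hΘ s₀ k hk hs hN i hi (congrArg Subtype.val h0)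

include hnd in
/-- **`(ε′_{s,i})ᵢ` IS `ℚ`-LINEARLY INDEPENDENT IN `End_Hdg(H^{2g−s}(X, ℚ))`** (complete towers `s₀ ≤ 1`): pairwise orthogonal non-zero idempotents. [cite: Lam2001FirstCourse, §21 (21.1)–(21.3)]
[cite: Lange2023AbelianVarietiesComplex, §6.3.4 Prop. 6.3.10 (p0318)] [cite: Kunnemann1993] -/
theorem linearIndependent_hodgeCornerEquiv_inv_smul_integralHodgeClassesCorrRingHom_pushforward_swapHom_lefschetzFamily (hΘ : nsDivPower X Θ gX = D • pointIntegralHodgeClass X eX) (s₀ k : ℕ) (hk : s₀ + 2 * k ≤ gX + 1) (hs : s₀ + 2 * k ≤ gX)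
    (hN : lefschetzFamilyConstant gX D s₀ k ≠ 0) {t : ℕ} (hst : (s₀ + 2 * k) + t = gX + gX) (ht : t ≤ gX + gX) (hs₀ : s₀ ≤ 1) :
    LinearIndependent ℚ (fun i : Fin (k + 1) ↦ CorrRing.hodgeCornerEquiv X.toIsog.Φ f hf f' ⟨t, Nat.lt_succ_of_le ht⟩
        ⟨_, inv_smul_integralHodgeClassesCorrRingHom_pushforward_swapHom_lefschetzFamily_mem_corner X hTX eX eXX eT hX0 hgX hcX hgXX hgg₂ hN' hgT f hf f' Θ D hbc₁ hl₁ hl₁' h7 h7' hmX hΛL h9 h9' hΘ s₀ k hk hst i⟩) := by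
  refine linearIndependent_of_isIdempotentElem_of_mul_eq_zero (A := (hodgeStructure X.toIsog.Φ t).endAlg) _ (fun i ↦ ?_) (fun i j hij ↦ ?_) fun i ↦ ?_
  · exact isIdempotentElem_hodgeCornerEquiv_inv_smul_integralHodgeClassesCorrRingHom_pushforward_swapHom_lefschetzFamily X hTX eX eXX eT hX0 hgX hcX hgXX hgg₂ hN' hgT f hf f' Θ D hbc₁ hl₁ hl₁' h7 h7' hmX hΛL h9 h9' hΘ s₀ k hk hN hst ht i
  · exact hodgeCornerEquiv_inv_smul_integralHodgeClassesCorrRingHom_pushforward_swapHom_lefschetzFamily_mul_of_ne X hTX eX eXX eT hX0 hgX hcX hgXX hgg₂ hN' hgT f hf f' Θ D hbc₁ hl₁ hl₁' h7 h7' hmX hΛL h9 h9' hΘ s₀ k hk hst ht hij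
  · exact hodgeCornerEquiv_inv_smul_integralHodgeClassesCorrRingHom_pushforward_swapHom_lefschetzFamily_ne_zero X hTX eX eXX eT hX0 hgX hcX hgXX hgg₂ hN' hgT f hf f' Θ D hbc₁ hl₁ hl₁' h7 h7' hmX hΛL h9 h9' hnd hΘ s₀ k hk hs hN hst ht i (Or.inr hs₀)

include hnd in
/-- **`(e′_{s,0}, …, e′_{s,k})` IS `ℚ`-LINEARLY INDEPENDENT IN p08's ALGEBRA OF CORRESPONDENCES** (`N_s ≠ 0`, complete towers): pairwise orthogonal non-zero idempotents (✔ g44-#2).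
[cite: Lam2001FirstCourse, §21 (21.1)–(21.3)] [cite: Lange2023AbelianVarietiesComplex, §6.3.4 Prop. 6.3.10 (p0318)] [cite: Kunnemann1993] -/
theorem linearIndependent_inv_smul_integralHodgeClassesCorrRingHom_pushforward_swapHom_lefschetzFamily (hΘ : nsDivPower X Θ gX = D • pointIntegralHodgeClass X eX) (s₀ k : ℕ)
    (hk : s₀ + 2 * k ≤ gX + 1) (hs : s₀ + 2 * k ≤ gX) (hN : lefschetzFamilyConstant gX D s₀ k ≠ 0) (hs₀ : s₀ ≤ 1) :
    LinearIndependent ℚ fun i : Fin (k + 1) ↦ (lefschetzFamilyConstant gX D s₀ k : ℚ)⁻¹ • integralHodgeClassesCorrRingHom X hTX eX eXX eT hX0 hgX hcX hgXX hgg₂ hN' hgT f hf f'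
        (integralHodgeClassesPushforward gX gX (swapHom X X) eXX eXX hcX hgXX hcX hgXX
          (lefschetzFamily X eX eXX eT hX0 hgX hcX hgXX hgT hN' hgg₂ Θ D hbc₁ hl₁ hl₁' h7 h7' hmX hΛL h9 h9' s₀ k hk i)) :=
  linearIndependent_of_isIdempotentElem_of_mul_eq_zero _
    (isIdempotentElem_inv_smul_integralHodgeClassesCorrRingHom_pushforward_swapHom_lefschetzFamily X hTX eX eXX eT hX0 hgX hcX hgXX hgg₂ hN' hgT f hf f' Θ D hbc₁ hl₁ hl₁' h7 h7' hmX hΛL h9 h9' hΘ s₀ k hk hN)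
    (fun _ _ hij ↦ inv_smul_integralHodgeClassesCorrRingHom_pushforward_swapHom_lefschetzFamily_mul_of_ne X hTX eX eXX eT hX0 hgX hcX hgXX hgg₂ hN' hgT f hf f' Θ D hbc₁ hl₁ hl₁' h7 h7' hmX hΛL h9 h9' hΘ s₀ k hk hij)
    (fun i ↦ inv_smul_integralHodgeClassesCorrRingHom_pushforward_swapHom_lefschetzFamily_ne_zero X hTX eX eXX eT hX0 hgX hcX hgXX hgg₂ hN' hgT f hf f' Θ D hbc₁ hl₁ hl₁' h7 h7' hmX hΛL h9 h9' hnd hΘ s₀ k hk hs hN i (Or.inr hs₀))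

/-- `e′_{s,i}` lies in p08's corner subspace `π_{2g−s} ∘ Bᵍ(X × X)` (`π_{2g−s} ∘ e′_{s,i} = e′_{s,i}`, ✔ g44-#4). [cite: Lange2023AbelianVarietiesComplex, §6.3.4 Prop. 6.3.10 (p0318)] [cite: Kahn2020, §6.9 Def. 6.28] -/
theorem inv_smul_integralHodgeClassesCorrRingHom_pushforward_swapHom_lefschetzFamily_mem_hodgeCornerSubmodule (hΘ : nsDivPower X Θ gX = D • pointIntegralHodgeClass X eX) (s₀ k : ℕ)
    (hk : s₀ + 2 * k ≤ gX + 1) {t : ℕ} (hst : (s₀ + 2 * k) + t = gX + gX) (i : Fin (k + 1)) :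
    (⟨_, inv_smul_integralHodgeClassesCorrRingHom_pushforward_swapHom_lefschetzFamily_mem_hodgeCorr X hTX eX eXX eT hX0 hgX hcX hgXX hgg₂ hN' hgT f hf f' Θ D hbc₁ hl₁ hl₁' h7 h7' hmX hΛL h9 h9' s₀ k hk i⟩ : CorrRing.hodgeCorr X.toIsog.Φ f hf f') ∈
      CorrRing.hodgeCornerSubmodule X.toIsog.Φ f hf f' t :=
  (CorrRing.mem_hodgeCornerSubmodule_iff X.toIsog.Φ f hf f').2
    (kunnethIdem_mul_inv_smul_integralHodgeClassesCorrRingHom_pushforward_swapHom_lefschetzFamily X hTX eX eXX eT hX0 hgX hcX hgXX hgg₂ hN' hgT f hf f' Θ D hbc₁ hl₁ hl₁' h7 h7' hmX hΛL h9 h9' hΘ s₀ k hk hst i)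

include hnd hθ in
/-- **`Hg(X) = Sp` ⟹ EVERY HODGE ENDOMORPHISM OF `H^{2g−s}(X, ℚ)` IS `Σᵢ cᵢ ε′_{s,i}`, `cᵢ ∈ ℚ`** (`s = s₀ + 2k ≤ g`, `s₀ ≤ 1`, `s + t = 2g`; on the underlying `ℚ`-linear maps): the `e′_{s,i}` are `k + 1` linearly
independent members of p08's corner subspace `π_t ∘ Bᵍ(X × X) ≃ₗ End_Hdg(Hᵗ(X, ℚ))` of dimension `⌊min(t, 2g−t)/2⌋ + 1 = k + 1` (✔ g45-#7), hence span it. `End_Hdg(H^{2g−s}(X, ℚ)) = ⊕ᵢ ℚ ε′_{s,i}`.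
[cite: Lange2023AbelianVarietiesComplex, §7.2.2 Thm. 7.2.4 (p0331), §7.3.2 (3) (p0338 L12–L16) and §6.3.4 Prop. 6.3.10] [cite: GoodmanWallachGTM255, §5.5.1 Cor. 5.5.9 (5.54)] [cite: Kahn2020, §3.5.2 Prop. 3.45 and §6.9 Def. 6.28] [cite: Kunnemann1993] -/
theorem exists_coe_eq_sum_smul_coe_hodgeCornerEquiv_inv_smul_integralHodgeClassesCorrRingHom_pushforward_swapHom_lefschetzFamily_of_hodgeGroup_eq_spGroup (hHg : ComplexTorus.hodgeGroup X.toIsog.Φ = ComplexTorus.spGroup X.toIsog.Φ (θ : X.toIsog.E [⋀^Fin 2]→L[ℝ] ℝ))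
    (hΘ : nsDivPower X Θ gX = D • pointIntegralHodgeClass X eX) (s₀ k : ℕ) (hk : s₀ + 2 * k ≤ gX + 1) (hs : s₀ + 2 * k ≤ gX)
    (hN : lefschetzFamilyConstant gX D s₀ k ≠ 0) {t : ℕ} (hst : (s₀ + 2 * k) + t = gX + gX) (ht : t ≤ gX + gX) (hs₀ : s₀ ≤ 1) (A : (hodgeStructure X.toIsog.Φ t).endAlg) :
    ∃ c : Fin (k + 1) → ℚ, (A : Module.End ℚ (rationalForms X.toIsog.Φ t)) = ∑ i, c i • ((CorrRing.hodgeCornerEquiv X.toIsog.Φ f hf f' ⟨t, Nat.lt_succ_of_le ht⟩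
        ⟨_, inv_smul_integralHodgeClassesCorrRingHom_pushforward_swapHom_lefschetzFamily_mem_corner X hTX eX eXX eT hX0 hgX hcX hgXX hgg₂ hN' hgT f hf f' Θ D hbc₁ hl₁ hl₁' h7 h7' hmX hΛL h9 h9' hΘ s₀ k hk hst i⟩ : (hodgeStructure X.toIsog.Φ t).endAlg) : Module.End ℚ (rationalForms X.toIsog.Φ t)) := by
  -- the family `e′_{s,i}` inside p08's corner subspace `π_t ∘ Bᵍ(X × X)`: linearly independent with `dim` members, hence spanning
  let w : Fin (k + 1) → CorrRing.hodgeCornerSubmodule X.toIsog.Φ f hf f' t := fun i ↦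
    ⟨_, inv_smul_integralHodgeClassesCorrRingHom_pushforward_swapHom_lefschetzFamily_mem_hodgeCornerSubmodule X hTX eX eXX eT hX0 hgX hcX hgXX hgg₂ hN' hgT f hf f' Θ D hbc₁ hl₁ hl₁' h7 h7' hmX hΛL h9 h9' hΘ s₀ k hk hst i⟩
  have hw : LinearIndependent ℚ w := by
    refine LinearIndependent.of_comp ((CorrRing.hodgeCorr X.toIsog.Φ f hf f').val.toLinearMap ∘ₗ (CorrRing.hodgeCornerSubmodule X.toIsog.Φ f hf f' t).subtype) ?_
    exact linearIndependent_inv_smul_integralHodgeClassesCorrRingHom_pushforward_swapHom_lefschetzFamily X hTX eX eXX eT hX0 hgX hcX hgXX hgg₂ hN' hgT f hf f' Θ D hbc₁ hl₁ hl₁' h7 h7' hmX hΛL h9 h9' hnd hΘ s₀ k hk hs hN hs₀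
  have hg := finrank_eq₆₄ X eX
  have hdim := finrank_endAlg_hodgeStructure_of_hodgeGroup_eq_spGroup X hθ hHg (s := t) (by rw [hg]; omega)
  rw [hg, min_eq_right (by omega), show (2 * gX - t) / 2 = k by omega] at hdim
  have hcard : Fintype.card (Fin (k + 1)) = finrank ℚ (CorrRing.hodgeCornerSubmodule X.toIsog.Φ f hf f' t) := by
    rw [Fintype.card_fin]
    exact hdim.symm.trans (CorrRing.finrank_hodgeCornerSubmodule X.toIsog.Φ f hf f' ⟨t, Nat.lt_succ_of_le ht⟩).symm
  have hspan := hw.span_eq_top_of_card_eq_finrank' hcard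
  -- the Hodge correspondence `u ∈ π_t ∘ Bᵍ(X × X) ∘ π_t` behind `A`, expanded on that basis
  set x := (CorrRing.hodgeCornerEquiv X.toIsog.Φ f hf f' ⟨t, Nat.lt_succ_of_le ht⟩).symm A with hx
  have hxmem : (x.1 : CorrRing.hodgeCorr X.toIsog.Φ f hf f') ∈ CorrRing.hodgeCornerSubmodule X.toIsog.Φ f hf f' t :=
    (CorrRing.mem_hodgeCornerSubmodule_iff X.toIsog.Φ f hf f').2 ((CorrRing.mem_corner_hodgeKunnethIdem_iff X.toIsog.Φ f hf f').1 x.2)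
  obtain ⟨c, hc⟩ := (Submodule.mem_span_range_iff_exists_fun ℚ).1 (Submodule.eq_top_iff'.1 hspan ⟨_, hxmem⟩)
  refine ⟨c, ?_⟩
  -- read the expansion on `Hᵗ(X, ℚ)` through the linear map `u ↦ u_*|Hᵗ(X, ℚ)`
  have hc' := congrArg (fun y : CorrRing.hodgeCornerSubmodule X.toIsog.Φ f hf f' t ↦
    CorrRing.hodgeActAlgHom X.toIsog.Φ f hf f' ⟨t, Nat.lt_succ_of_le ht⟩ (y : CorrRing.hodgeCorr X.toIsog.Φ f hf f')) hc
  simp only [Submodule.coe_sum, Submodule.coe_smul, map_sum, map_smul] at hc'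
  have hA : (A : Module.End ℚ (rationalForms X.toIsog.Φ t)) = CorrRing.hodgeActAlgHom X.toIsog.Φ f hf f' ⟨t, Nat.lt_succ_of_le ht⟩ (x.1 : CorrRing.hodgeCorr X.toIsog.Φ f hf f') := by
    rw [CorrRing.hodgeActAlgHom_apply, ← CorrRing.coe_hodgeCornerEquiv_apply, hx, RingEquiv.apply_symm_apply]
  refine hA.trans (hc'.symm.trans (Finset.sum_congr rfl fun i _ ↦ congrArg (c i • ·) ?_))
  exact CorrRing.hodgeActAlgHom_apply X.toIsog.Φ f hf f' ⟨t, Nat.lt_succ_of_le ht⟩ _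

include hTX eX eXX eT hX0 hgX hcX hgXX hgg₂ hN' hgT f hf f' Θ D hbc₁ hl₁ hl₁' h7 h7' hmX hΛL h9 h9' hnd hθ in
/-- **`Hg(X) = Sp` ⟹ `End_Hdg(H^{2g−s}(X, ℚ)) ≅ ℚ × ⋯ × ℚ` (`⌊s/2⌋ + 1` factors) AS `ℚ`-ALGEBRAS** (`s = s₀ + 2k ≤ g`, `s₀ ≤ 1`, `s + t = 2g`): the split commutative algebra on the transposed projectors
`ε′_{s,i}` onto `L^{g−s+i} H^{s−2i}(X, ℚ)_prim` (✔ g46-#1's bookkeeping `nonempty_subalgebra_algEquiv_pi_…`). [cite: Lange2023AbelianVarietiesComplex, §7.2.2 Thm. 7.2.4 (p0331), §7.3.2 (3) (p0338 L12–L16) and §6.3.4 Prop. 6.3.10]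
[cite: GoodmanWallachGTM255, §5.5.1 Cor. 5.5.9 (5.54)] [cite: Lam2001FirstCourse, §22 (22.1)–(22.2)] [cite: Kunnemann1993] -/
theorem nonempty_endAlg_hodgeStructure_algEquiv_pi_of_add_eq_of_hodgeGroup_eq_spGroup (hHg : ComplexTorus.hodgeGroup X.toIsog.Φ = ComplexTorus.spGroup X.toIsog.Φ (θ : X.toIsog.E [⋀^Fin 2]→L[ℝ] ℝ))
    (hΘ : nsDivPower X Θ gX = D • pointIntegralHodgeClass X eX) (s₀ k : ℕ) (hk : s₀ + 2 * k ≤ gX + 1) (hs : s₀ + 2 * k ≤ gX)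
    (hN : lefschetzFamilyConstant gX D s₀ k ≠ 0) {t : ℕ} (hst : (s₀ + 2 * k) + t = gX + gX) (ht : t ≤ gX + gX) (hs₀ : s₀ ≤ 1) :
    Nonempty ((hodgeStructure X.toIsog.Φ t).endAlg ≃ₐ[ℚ] (Fin (k + 1) → ℚ)) :=
  nonempty_subalgebra_algEquiv_pi_of_completeOrthogonalIdempotents_of_forall_exists _
    (completeOrthogonalIdempotents_hodgeCornerEquiv_inv_smul_integralHodgeClassesCorrRingHom_pushforward_swapHom_lefschetzFamily X hTX eX eXX eT hX0 hgX hcX hgXX hgg₂ hN' hgT f hf f' Θ D hbc₁ hl₁ hl₁' h7 h7' hmX hΛL h9 h9' hΘ s₀ k hk hN hst ht)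
    (linearIndependent_hodgeCornerEquiv_inv_smul_integralHodgeClassesCorrRingHom_pushforward_swapHom_lefschetzFamily X hTX eX eXX eT hX0 hgX hcX hgXX hgg₂ hN' hgT f hf f' Θ D hbc₁ hl₁ hl₁' h7 h7' hmX hΛL h9 h9' hnd hΘ s₀ k hk hs hN hst ht hs₀)
    (exists_coe_eq_sum_smul_coe_hodgeCornerEquiv_inv_smul_integralHodgeClassesCorrRingHom_pushforward_swapHom_lefschetzFamily_of_hodgeGroup_eq_spGroup X hTX eX eXX eT hX0 hgX hcX hgXX hgg₂ hN' hgT f hf f' Θ D hbc₁ hl₁ hl₁' h7 h7' hmX hΛL h9 h9' hnd hθ hHg hΘ s₀ k hk hs hN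
      hst ht hs₀)

/-! ## §2 `Hg = Sp`: the blocks and primitive idempotents of `End_Hdg(H^{2g−s}(X, ℚ))` are the `ε′_{s,i}`; the indecomposable decomposition of `H^{2g−s}(X, ℚ)` is unique -/

include hnd hθ in
/-- The three inputs of ✔ g46-#3/#4 §0 for `(ε′_{s,i})ᵢ` in `End_Hdg(H^{2g−s}(X, ℚ))` (`Hg = Sp`). [cite: Kunnemann1993] [cite: Lange2023AbelianVarietiesComplex, §7.3.2 (3) (p0338 L12–L16)] -/
private theorem epsp_hyps₆₄ (hHg : ComplexTorus.hodgeGroup X.toIsog.Φ = ComplexTorus.spGroup X.toIsog.Φ (θ : X.toIsog.E [⋀^Fin 2]→L[ℝ] ℝ))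
    (hΘ : nsDivPower X Θ gX = D • pointIntegralHodgeClass X eX) (s₀ k : ℕ) (hk : s₀ + 2 * k ≤ gX + 1) (hs : s₀ + 2 * k ≤ gX)
    (hN : lefschetzFamilyConstant gX D s₀ k ≠ 0) {t : ℕ} (hst : (s₀ + 2 * k) + t = gX + gX) (ht : t ≤ gX + gX) (hs₀ : s₀ ≤ 1) :
    CompleteOrthogonalIdempotents (fun i : Fin (k + 1) ↦ CorrRing.hodgeCornerEquiv X.toIsog.Φ f hf f' ⟨t, Nat.lt_succ_of_le ht⟩
        ⟨_, inv_smul_integralHodgeClassesCorrRingHom_pushforward_swapHom_lefschetzFamily_mem_corner X hTX eX eXX eT hX0 hgX hcX hgXX hgg₂ hN' hgT f hf f' Θ D hbc₁ hl₁ hl₁' h7 h7' hmX hΛL h9 h9' hΘ s₀ k hk hst i⟩) ∧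
      (∀ i : Fin (k + 1), CorrRing.hodgeCornerEquiv X.toIsog.Φ f hf f' ⟨t, Nat.lt_succ_of_le ht⟩
        ⟨_, inv_smul_integralHodgeClassesCorrRingHom_pushforward_swapHom_lefschetzFamily_mem_corner X hTX eX eXX eT hX0 hgX hcX hgXX hgg₂ hN' hgT f hf f' Θ D hbc₁ hl₁ hl₁' h7 h7' hmX hΛL h9 h9' hΘ s₀ k hk hst i⟩ ≠ 0) ∧
      ∀ A : (hodgeStructure X.toIsog.Φ t).endAlg, ∃ c : Fin (k + 1) → ℚ, (A : Module.End ℚ (rationalForms X.toIsog.Φ t)) =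
        ∑ i, c i • ((CorrRing.hodgeCornerEquiv X.toIsog.Φ f hf f' ⟨t, Nat.lt_succ_of_le ht⟩
        ⟨_, inv_smul_integralHodgeClassesCorrRingHom_pushforward_swapHom_lefschetzFamily_mem_corner X hTX eX eXX eT hX0 hgX hcX hgXX hgg₂ hN' hgT f hf f' Θ D hbc₁ hl₁ hl₁' h7 h7' hmX hΛL h9 h9' hΘ s₀ k hk hst i⟩ : (hodgeStructure X.toIsog.Φ t).endAlg) : Module.End ℚ (rationalForms X.toIsog.Φ t)) :=
  ⟨completeOrthogonalIdempotents_hodgeCornerEquiv_inv_smul_integralHodgeClassesCorrRingHom_pushforward_swapHom_lefschetzFamily X hTX eX eXX eT hX0 hgX hcX hgXX hgg₂ hN' hgT f hf f' Θ D hbc₁ hl₁ hl₁' h7 h7' hmX hΛL h9 h9' hΘ s₀ k hk hN hst ht,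
    fun i ↦ hodgeCornerEquiv_inv_smul_integralHodgeClassesCorrRingHom_pushforward_swapHom_lefschetzFamily_ne_zero X hTX eX eXX eT hX0 hgX hcX hgXX hgg₂ hN' hgT f hf f' Θ D hbc₁ hl₁ hl₁' h7 h7' hmX hΛL h9 h9' hnd hΘ s₀ k hk hs hN hst ht i (Or.inr hs₀),
    exists_coe_eq_sum_smul_coe_hodgeCornerEquiv_inv_smul_integralHodgeClassesCorrRingHom_pushforward_swapHom_lefschetzFamily_of_hodgeGroup_eq_spGroup X hTX eX eXX eT hX0 hgX hcX hgXX hgg₂ hN' hgT f hf f' Θ D hbc₁ hl₁ hl₁' h7 h7' hmX hΛL h9 h9' hnd hθ hHg hΘ s₀ k hk hs hN hst ht hs₀⟩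

include hnd hθ in
/-- **`Hg(X) = Sp` ⟹ `ε′_{s,i}` IS A BLOCK OF `End_Hdg(H^{2g−s}(X, ℚ))`.** [cite: Lange2023AbelianVarietiesComplex, §6.3.4 Prop. 6.3.10 (p0318), §7.2.2 Thm. 7.2.4 (p0331) and §7.3.2 (1)–(3) (p0338 L3–L16)] [cite: Lam2001FirstCourse, §22 Prop. (22.1), p. 325] [cite: Kahn2020, §3.5.2 Prop. 3.45, §6.6 Thm. 6.19 and App. A Thm. A.6 (p0135)] [cite: Kunnemann1993] -/
theorem isCentrallyPrimitive_hodgeCornerEquiv_inv_smul_integralHodgeClassesCorrRingHom_pushforward_swapHom_lefschetzFamily_of_hodgeGroup_eq_spGroup (hHg : ComplexTorus.hodgeGroup X.toIsog.Φ = ComplexTorus.spGroup X.toIsog.Φ (θ : X.toIsog.E [⋀^Fin 2]→L[ℝ] ℝ))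
    (hΘ : nsDivPower X Θ gX = D • pointIntegralHodgeClass X eX) (s₀ k : ℕ) (hk : s₀ + 2 * k ≤ gX + 1) (hs : s₀ + 2 * k ≤ gX)
    (hN : lefschetzFamilyConstant gX D s₀ k ≠ 0) {t : ℕ} (hst : (s₀ + 2 * k) + t = gX + gX) (ht : t ≤ gX + gX) (hs₀ : s₀ ≤ 1) (i : Fin (k + 1)) :
    IsCentrallyPrimitive (CorrRing.hodgeCornerEquiv X.toIsog.Φ f hf f' ⟨t, Nat.lt_succ_of_le ht⟩
        ⟨_, inv_smul_integralHodgeClassesCorrRingHom_pushforward_swapHom_lefschetzFamily_mem_corner X hTX eX eXX eT hX0 hgX hcX hgXX hgg₂ hN' hgT f hf f' Θ D hbc₁ hl₁ hl₁' h7 h7' hmX hΛL h9 h9' hΘ s₀ k hk hst i⟩) := by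
  obtain ⟨hv, hne, hsp⟩ := epsp_hyps₆₄ X hTX eX eXX eT hX0 hgX hcX hgXX hgg₂ hN' hgT f hf f' Θ D hbc₁ hl₁ hl₁' h7 h7' hmX hΛL h9 h9' hnd hθ hHg hΘ s₀ k hk hs hN hst ht hs₀
  exact isCentrallyPrimitive_of_forall_exists_coe_eq_sum_smul _ hv.toOrthogonalIdempotents hsp (hne i)

include hnd hθ in
/-- **`Hg(X) = Sp` ⟹ THE BLOCKS OF `End_Hdg(H^{2g−s}(X, ℚ))` ARE EXACTLY THE `ε′_{s,i}`.** [cite: Lange2023AbelianVarietiesComplex, §6.3.4 Prop. 6.3.10 (p0318), §7.2.2 Thm. 7.2.4 (p0331) and §7.3.2 (1)–(3) (p0338 L3–L16)] [cite: Lam2001FirstCourse, §22 Prop. (22.1), p. 325] [cite: Kahn2020, §3.5.2 Prop. 3.45, §6.6 Thm. 6.19 and App. A Thm. A.6 (p0135)] [cite: Kunnemann1993] -/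
theorem setOf_isCentrallyPrimitive_endAlg_eq_range_hodgeCornerEquiv_pushforward_swapHom_of_hodgeGroup_eq_spGroup (hHg : ComplexTorus.hodgeGroup X.toIsog.Φ = ComplexTorus.spGroup X.toIsog.Φ (θ : X.toIsog.E [⋀^Fin 2]→L[ℝ] ℝ))
    (hΘ : nsDivPower X Θ gX = D • pointIntegralHodgeClass X eX) (s₀ k : ℕ) (hk : s₀ + 2 * k ≤ gX + 1) (hs : s₀ + 2 * k ≤ gX)
    (hN : lefschetzFamilyConstant gX D s₀ k ≠ 0) {t : ℕ} (hst : (s₀ + 2 * k) + t = gX + gX) (ht : t ≤ gX + gX) (hs₀ : s₀ ≤ 1) :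
    {u : (hodgeStructure X.toIsog.Φ t).endAlg | IsCentrallyPrimitive u} = Set.range (fun i : Fin (k + 1) ↦ CorrRing.hodgeCornerEquiv X.toIsog.Φ f hf f' ⟨t, Nat.lt_succ_of_le ht⟩
        ⟨_, inv_smul_integralHodgeClassesCorrRingHom_pushforward_swapHom_lefschetzFamily_mem_corner X hTX eX eXX eT hX0 hgX hcX hgXX hgg₂ hN' hgT f hf f' Θ D hbc₁ hl₁ hl₁' h7 h7' hmX hΛL h9 h9' hΘ s₀ k hk hst i⟩) := by
  obtain ⟨hv, hne, hsp⟩ := epsp_hyps₆₄ X hTX eX eXX eT hX0 hgX hcX hgXX hgg₂ hN' hgT f hf f' Θ D hbc₁ hl₁ hl₁' h7 h7' hmX hΛL h9 h9' hnd hθ hHg hΘ s₀ k hk hs hN hst ht hs₀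
  exact setOf_isCentrallyPrimitive_eq_range_of_forall_exists_coe_eq_sum_smul _ hv hne hsp

include hnd hθ in
/-- **`Hg(X) = Sp` ⟹ THE PRIMITIVE IDEMPOTENTS OF `End_Hdg(H^{2g−s}(X, ℚ))` ARE EXACTLY THE `ε′_{s,i}`** (each `ε′_{s,i}` being primitive is ✔ g46-#4 / ✔ g45-#6's duality). [cite: Lange2023AbelianVarietiesComplex, §6.3.4 Prop. 6.3.10 (p0318), §7.2.2 Thm. 7.2.4 (p0331) and §7.3.2 (1)–(3) (p0338 L3–L16)] [cite: Lam2001FirstCourse, §22 Prop. (22.1), p. 325] [cite: Kahn2020, §3.5.2 Prop. 3.45, §6.6 Thm. 6.19 and App. A Thm. A.6 (p0135)] [cite: Kunnemann1993] -/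
theorem setOf_isPrimitiveIdempotent_endAlg_eq_range_hodgeCornerEquiv_pushforward_swapHom_of_hodgeGroup_eq_spGroup (hHg : ComplexTorus.hodgeGroup X.toIsog.Φ = ComplexTorus.spGroup X.toIsog.Φ (θ : X.toIsog.E [⋀^Fin 2]→L[ℝ] ℝ))
    (hΘ : nsDivPower X Θ gX = D • pointIntegralHodgeClass X eX) (s₀ k : ℕ) (hk : s₀ + 2 * k ≤ gX + 1) (hs : s₀ + 2 * k ≤ gX)
    (hN : lefschetzFamilyConstant gX D s₀ k ≠ 0) {t : ℕ} (hst : (s₀ + 2 * k) + t = gX + gX) (ht : t ≤ gX + gX) (hs₀ : s₀ ≤ 1) :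
    {u : (hodgeStructure X.toIsog.Φ t).endAlg | IsPrimitiveIdempotent u} = Set.range (fun i : Fin (k + 1) ↦ CorrRing.hodgeCornerEquiv X.toIsog.Φ f hf f' ⟨t, Nat.lt_succ_of_le ht⟩
        ⟨_, inv_smul_integralHodgeClassesCorrRingHom_pushforward_swapHom_lefschetzFamily_mem_corner X hTX eX eXX eT hX0 hgX hcX hgXX hgg₂ hN' hgT f hf f' Θ D hbc₁ hl₁ hl₁' h7 h7' hmX hΛL h9 h9' hΘ s₀ k hk hst i⟩) := by
  obtain ⟨hv, hne, hsp⟩ := epsp_hyps₆₄ X hTX eX eXX eT hX0 hgX hcX hgXX hgg₂ hN' hgT f hf f' Θ D hbc₁ hl₁ hl₁' h7 h7' hmX hΛL h9 h9' hnd hθ hHg hΘ s₀ k hk hs hN hst ht hs₀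
  exact setOf_isPrimitiveIdempotent_eq_range_of_forall_exists_coe_eq_sum_smul _ hv hne hsp

include hTX eX eXX eT hX0 hgX hcX hgXX hgg₂ hN' hgT f hf f' Θ D hbc₁ hl₁ hl₁' h7 h7' hmX hΛL h9 h9' hnd hθ in
/-- **`Hg(X) = Sp` ⟹ `End_Hdg(H^{2g−s}(X, ℚ))` HAS EXACTLY `⌊s/2⌋ + 1` BLOCKS.** [cite: Lange2023AbelianVarietiesComplex, §6.3.4 Prop. 6.3.10 (p0318), §7.2.2 Thm. 7.2.4 (p0331) and §7.3.2 (1)–(3) (p0338 L3–L16)] [cite: Lam2001FirstCourse, §22 Prop. (22.1), p. 325] [cite: Kahn2020, §3.5.2 Prop. 3.45, §6.6 Thm. 6.19 and App. A Thm. A.6 (p0135)] [cite: Kunnemann1993] -/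
theorem ncard_setOf_isCentrallyPrimitive_endAlg_of_add_eq_of_hodgeGroup_eq_spGroup (hHg : ComplexTorus.hodgeGroup X.toIsog.Φ = ComplexTorus.spGroup X.toIsog.Φ (θ : X.toIsog.E [⋀^Fin 2]→L[ℝ] ℝ))
    (hΘ : nsDivPower X Θ gX = D • pointIntegralHodgeClass X eX) (s₀ k : ℕ) (hk : s₀ + 2 * k ≤ gX + 1) (hs : s₀ + 2 * k ≤ gX)
    (hN : lefschetzFamilyConstant gX D s₀ k ≠ 0) {t : ℕ} (hst : (s₀ + 2 * k) + t = gX + gX) (ht : t ≤ gX + gX) (hs₀ : s₀ ≤ 1) :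
    {u : (hodgeStructure X.toIsog.Φ t).endAlg | IsCentrallyPrimitive u}.ncard = k + 1 := by
  obtain ⟨hv, hne, hsp⟩ := epsp_hyps₆₄ X hTX eX eXX eT hX0 hgX hcX hgXX hgg₂ hN' hgT f hf f' Θ D hbc₁ hl₁ hl₁' h7 h7' hmX hΛL h9 h9' hnd hθ hHg hΘ s₀ k hk hs hN hst ht hs₀
  rw [ncard_setOf_isCentrallyPrimitive_of_forall_exists_coe_eq_sum_smul _ hv hne hsp, Fintype.card_fin]

include hTX eX eXX eT hX0 hgX hcX hgXX hgg₂ hN' hgT f hf f' Θ D hbc₁ hl₁ hl₁' h7 h7' hmX hΛL h9 h9' hnd hθ in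
/-- **`Hg(X) = Sp` ⟹ `End_Hdg(H^{2g−s}(X, ℚ))` HAS EXACTLY `⌊s/2⌋ + 1` PRIMITIVE IDEMPOTENTS.** [cite: Lange2023AbelianVarietiesComplex, §6.3.4 Prop. 6.3.10 (p0318), §7.2.2 Thm. 7.2.4 (p0331) and §7.3.2 (1)–(3) (p0338 L3–L16)] [cite: Lam2001FirstCourse, §22 Prop. (22.1), p. 325] [cite: Kahn2020, §3.5.2 Prop. 3.45, §6.6 Thm. 6.19 and App. A Thm. A.6 (p0135)] [cite: Kunnemann1993] -/
theorem ncard_setOf_isPrimitiveIdempotent_endAlg_of_add_eq_of_hodgeGroup_eq_spGroup (hHg : ComplexTorus.hodgeGroup X.toIsog.Φ = ComplexTorus.spGroup X.toIsog.Φ (θ : X.toIsog.E [⋀^Fin 2]→L[ℝ] ℝ))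
    (hΘ : nsDivPower X Θ gX = D • pointIntegralHodgeClass X eX) (s₀ k : ℕ) (hk : s₀ + 2 * k ≤ gX + 1) (hs : s₀ + 2 * k ≤ gX)
    (hN : lefschetzFamilyConstant gX D s₀ k ≠ 0) {t : ℕ} (hst : (s₀ + 2 * k) + t = gX + gX) (ht : t ≤ gX + gX) (hs₀ : s₀ ≤ 1) :
    {u : (hodgeStructure X.toIsog.Φ t).endAlg | IsPrimitiveIdempotent u}.ncard = k + 1 := by
  obtain ⟨hv, hne, hsp⟩ := epsp_hyps₆₄ X hTX eX eXX eT hX0 hgX hcX hgXX hgg₂ hN' hgT f hf f' Θ D hbc₁ hl₁ hl₁' h7 h7' hmX hΛL h9 h9' hnd hθ hHg hΘ s₀ k hk hs hN hst ht hs₀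
  rw [ncard_setOf_isPrimitiveIdempotent_of_forall_exists_coe_eq_sum_smul _ hv hne hsp, Fintype.card_fin]

include hnd hθ in
/-- **`Hg(X) = Sp` ⟹ every idempotent Hodge endomorphism of `H^{2g−s}(X, ℚ)` is `Σ_{i ∈ S} ε′_{s,i}` for a unique `S`.** [cite: Lam2001FirstCourse, §22 Prop. (22.1) (1) and (3), p. 325] [cite: Lange2023AbelianVarietiesComplex, §6.3.4 Prop. 6.3.10 (p0318), §7.2.2 Thm. 7.2.4 (p0331) and §7.3.2 (1)–(3) (p0338 L3–L16)] [cite: Lam2001FirstCourse, §22 Prop. (22.1), p. 325] [cite: Kahn2020, §3.5.2 Prop. 3.45, §6.6 Thm. 6.19 and App. A Thm. A.6 (p0135)] [cite: Kunnemann1993] -/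
theorem existsUnique_eq_sum_hodgeCornerEquiv_pushforward_swapHom_of_isIdempotentElem_endAlg_of_hodgeGroup_eq_spGroup (hHg : ComplexTorus.hodgeGroup X.toIsog.Φ = ComplexTorus.spGroup X.toIsog.Φ (θ : X.toIsog.E [⋀^Fin 2]→L[ℝ] ℝ))
    (hΘ : nsDivPower X Θ gX = D • pointIntegralHodgeClass X eX) (s₀ k : ℕ) (hk : s₀ + 2 * k ≤ gX + 1) (hs : s₀ + 2 * k ≤ gX)
    (hN : lefschetzFamilyConstant gX D s₀ k ≠ 0) {t : ℕ} (hst : (s₀ + 2 * k) + t = gX + gX) (ht : t ≤ gX + gX) (hs₀ : s₀ ≤ 1) {u : (hodgeStructure X.toIsog.Φ t).endAlg} (hu : IsIdempotentElem u) :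
    ∃! S : Finset (Fin (k + 1)), u = ∑ i ∈ S, CorrRing.hodgeCornerEquiv X.toIsog.Φ f hf f' ⟨t, Nat.lt_succ_of_le ht⟩
        ⟨_, inv_smul_integralHodgeClassesCorrRingHom_pushforward_swapHom_lefschetzFamily_mem_corner X hTX eX eXX eT hX0 hgX hcX hgXX hgg₂ hN' hgT f hf f' Θ D hbc₁ hl₁ hl₁' h7 h7' hmX hΛL h9 h9' hΘ s₀ k hk hst i⟩ := by
  obtain ⟨hv, hne, hsp⟩ := epsp_hyps₆₄ X hTX eX eXX eT hX0 hgX hcX hgXX hgg₂ hN' hgT f hf f' Θ D hbc₁ hl₁ hl₁' h7 h7' hmX hΛL h9 h9' hnd hθ hHg hΘ s₀ k hk hs hN hst ht hs₀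
  exact existsUnique_eq_sum_of_isIdempotentElem_of_forall_exists_coe_eq_sum_smul _ hv hne hsp hu

include hTX eX eXX eT hX0 hgX hcX hgXX hgg₂ hN' hgT f hf f' Θ D hbc₁ hl₁ hl₁' h7 h7' hmX hΛL h9 h9' hnd hθ in
/-- **`Hg(X) = Sp` ⟹ `End_Hdg(H^{2g−s}(X, ℚ))` HAS EXACTLY `2^{⌊s/2⌋+1}` IDEMPOTENTS** (direct-summand sub-Hodge structures of `H^{2g−s}(X, ℚ)`). [cite: Lam2001FirstCourse, §22 Prop. (22.1) (1) and (3), p. 325] [cite: Lange2023AbelianVarietiesComplex, §6.3.4 Prop. 6.3.10 (p0318), §7.2.2 Thm. 7.2.4 (p0331) and §7.3.2 (1)–(3) (p0338 L3–L16)] [cite: Lam2001FirstCourse, §22 Prop. (22.1), p. 325] [cite: Kahn2020, §3.5.2 Prop. 3.45, §6.6 Thm. 6.19 and App. A Thm. A.6 (p0135)] [cite: Kunnemann1993] -/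
theorem ncard_setOf_isIdempotentElem_endAlg_of_add_eq_of_hodgeGroup_eq_spGroup (hHg : ComplexTorus.hodgeGroup X.toIsog.Φ = ComplexTorus.spGroup X.toIsog.Φ (θ : X.toIsog.E [⋀^Fin 2]→L[ℝ] ℝ))
    (hΘ : nsDivPower X Θ gX = D • pointIntegralHodgeClass X eX) (s₀ k : ℕ) (hk : s₀ + 2 * k ≤ gX + 1) (hs : s₀ + 2 * k ≤ gX)
    (hN : lefschetzFamilyConstant gX D s₀ k ≠ 0) {t : ℕ} (hst : (s₀ + 2 * k) + t = gX + gX) (ht : t ≤ gX + gX) (hs₀ : s₀ ≤ 1) :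
    {u : (hodgeStructure X.toIsog.Φ t).endAlg | IsIdempotentElem u}.ncard = 2 ^ (k + 1) := by
  obtain ⟨hv, hne, hsp⟩ := epsp_hyps₆₄ X hTX eX eXX eT hX0 hgX hcX hgXX hgg₂ hN' hgT f hf f' Θ D hbc₁ hl₁ hl₁' h7 h7' hmX hΛL h9 h9' hnd hθ hHg hΘ s₀ k hk hs hN hst ht hs₀
  rw [ncard_setOf_isIdempotentElem_of_forall_exists_coe_eq_sum_smul _ hv hne hsp, Fintype.card_fin]

include hnd hθ in
/-- **`Hg(X) = Sp` ⟹ THE DECOMPOSITION OF `H^{2g−s}(X, ℚ)` INTO INDECOMPOSABLE SUB-`ℚ`-HODGE STRUCTURES IS UNIQUE — IT IS `⊕ᵢ L^{g−s+i} H^{s−2i}(X, ℚ)_prim`**: a finite set of pairwise orthogonal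
primitive idempotents of `End_Hdg(H^{2g−s}(X, ℚ))` sums to `1` iff it is `{ε′_{s,0}, …, ε′_{s,k}}`. [cite: Lam2001FirstCourse, §22 Prop. (22.1) (2)–(3), p. 325] [cite: Lange2023AbelianVarietiesComplex, §6.3.4 Prop. 6.3.10 (p0318), §7.2.2 Thm. 7.2.4 (p0331) and §7.3.2 (1)–(3) (p0338 L3–L16)] [cite: Lam2001FirstCourse, §22 Prop. (22.1), p. 325] [cite: Kahn2020, §3.5.2 Prop. 3.45, §6.6 Thm. 6.19 and App. A Thm. A.6 (p0135)] [cite: Kunnemann1993] [cite: Milne1999LefschetzClasses, §5 p. 664 (p0026 L40–L50)] -/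
theorem isPrimitiveDecomposition_endAlg_one_iff_coe_eq_range_hodgeCornerEquiv_pushforward_swapHom_of_hodgeGroup_eq_spGroup (hHg : ComplexTorus.hodgeGroup X.toIsog.Φ = ComplexTorus.spGroup X.toIsog.Φ (θ : X.toIsog.E [⋀^Fin 2]→L[ℝ] ℝ))
    (hΘ : nsDivPower X Θ gX = D • pointIntegralHodgeClass X eX) (s₀ k : ℕ) (hk : s₀ + 2 * k ≤ gX + 1) (hs : s₀ + 2 * k ≤ gX)
    (hN : lefschetzFamilyConstant gX D s₀ k ≠ 0) {t : ℕ} (hst : (s₀ + 2 * k) + t = gX + gX) (ht : t ≤ gX + gX) (hs₀ : s₀ ≤ 1) {T : Finset ((hodgeStructure X.toIsog.Φ t).endAlg)} :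
    IsPrimitiveDecomposition T 1 ↔ (T : Set ((hodgeStructure X.toIsog.Φ t).endAlg)) = Set.range (fun i : Fin (k + 1) ↦ CorrRing.hodgeCornerEquiv X.toIsog.Φ f hf f' ⟨t, Nat.lt_succ_of_le ht⟩
        ⟨_, inv_smul_integralHodgeClassesCorrRingHom_pushforward_swapHom_lefschetzFamily_mem_corner X hTX eX eXX eT hX0 hgX hcX hgXX hgg₂ hN' hgT f hf f' Θ D hbc₁ hl₁ hl₁' h7 h7' hmX hΛL h9 h9' hΘ s₀ k hk hst i⟩) := by
  obtain ⟨hv, hne, hsp⟩ := epsp_hyps₆₄ X hTX eX eXX eT hX0 hgX hcX hgXX hgg₂ hN' hgT f hf f' Θ D hbc₁ hl₁ hl₁' h7 h7' hmX hΛL h9 h9' hnd hθ hHg hΘ s₀ k hk hs hN hst ht hs₀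
  exact isPrimitiveDecomposition_one_iff_coe_eq_range_of_forall_exists_coe_eq_sum_smul _ hv hne hsp

include hTX eX eXX eT hX0 hgX hcX hgXX hgg₂ hN' hgT f hf f' Θ D hbc₁ hl₁ hl₁' h7 h7' hmX hΛL h9 h9' hnd hθ in
/-- **`Hg(X) = Sp` ⟹ `H^{2g−s}(X, ℚ)` HAS EXACTLY ONE DECOMPOSITION INTO INDECOMPOSABLE SUB-`ℚ`-HODGE STRUCTURES** (`s = s₀ + 2k ≤ g`, `s + t = 2g`). [cite: Lam2001FirstCourse, §22 Prop. (22.1) (3), p. 325] [cite: Lange2023AbelianVarietiesComplex, §6.3.4 Prop. 6.3.10 (p0318), §7.2.2 Thm. 7.2.4 (p0331) and §7.3.2 (1)–(3) (p0338 L3–L16)] [cite: Lam2001FirstCourse, §22 Prop. (22.1), p. 325] [cite: Kahn2020, §3.5.2 Prop. 3.45, §6.6 Thm. 6.19 and App. A Thm. A.6 (p0135)] [cite: Kunnemann1993] -/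
theorem existsUnique_isPrimitiveDecomposition_endAlg_one_of_add_eq_of_hodgeGroup_eq_spGroup (hHg : ComplexTorus.hodgeGroup X.toIsog.Φ = ComplexTorus.spGroup X.toIsog.Φ (θ : X.toIsog.E [⋀^Fin 2]→L[ℝ] ℝ))
    (hΘ : nsDivPower X Θ gX = D • pointIntegralHodgeClass X eX) (s₀ k : ℕ) (hk : s₀ + 2 * k ≤ gX + 1) (hs : s₀ + 2 * k ≤ gX)
    (hN : lefschetzFamilyConstant gX D s₀ k ≠ 0) {t : ℕ} (hst : (s₀ + 2 * k) + t = gX + gX) (ht : t ≤ gX + gX) (hs₀ : s₀ ≤ 1) :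
    ∃! T : Finset ((hodgeStructure X.toIsog.Φ t).endAlg), IsPrimitiveDecomposition T 1 := by
  obtain ⟨hv, hne, hsp⟩ := epsp_hyps₆₄ X hTX eX eXX eT hX0 hgX hcX hgXX hgg₂ hN' hgT f hf f' Θ D hbc₁ hl₁ hl₁' h7 h7' hmX hΛL h9 h9' hnd hθ hHg hΘ s₀ k hk hs hN hst ht hs₀
  exact existsUnique_isPrimitiveDecomposition_one_of_forall_exists_coe_eq_sum_smul _ hv hne hsp

include hnd hθ in
/-- **`Hg(X) = Sp` ⟹ every splitting of `H^{2g−s}(X, ℚ)` into indecomposable sub-Hodge structures is a re-indexing of `(ε′_{s,i})ᵢ`.** [cite: Lam2001FirstCourse, §22 Prop. (22.1) (3), p. 325] [cite: Lange2023AbelianVarietiesComplex, §6.3.4 Prop. 6.3.10 (p0318), §7.2.2 Thm. 7.2.4 (p0331) and §7.3.2 (1)–(3) (p0338 L3–L16)] [cite: Lam2001FirstCourse, §22 Prop. (22.1), p. 325] [cite: Kahn2020, §3.5.2 Prop. 3.45, §6.6 Thm. 6.19 and App. A Thm. A.6 (p0135)] [cite: Kunnemann1993] -/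
theorem exists_equiv_eq_hodgeCornerEquiv_pushforward_swapHom_of_completeOrthogonalIdempotents_endAlg_of_hodgeGroup_eq_spGroup (hHg : ComplexTorus.hodgeGroup X.toIsog.Φ = ComplexTorus.spGroup X.toIsog.Φ (θ : X.toIsog.E [⋀^Fin 2]→L[ℝ] ℝ))
    (hΘ : nsDivPower X Θ gX = D • pointIntegralHodgeClass X eX) (s₀ k : ℕ) (hk : s₀ + 2 * k ≤ gX + 1) (hs : s₀ + 2 * k ≤ gX)
    (hN : lefschetzFamilyConstant gX D s₀ k ≠ 0) {t : ℕ} (hst : (s₀ + 2 * k) + t = gX + gX) (ht : t ≤ gX + gX) (hs₀ : s₀ ≤ 1) {J : Type*} [Fintype J] {w : J → (hodgeStructure X.toIsog.Φ t).endAlg}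
    (hw : CompleteOrthogonalIdempotents w) (hwp : ∀ j, IsPrimitiveIdempotent (w j)) : ∃ σ : Fin (k + 1) ≃ J, ∀ i, w (σ i) = CorrRing.hodgeCornerEquiv X.toIsog.Φ f hf f' ⟨t, Nat.lt_succ_of_le ht⟩
        ⟨_, inv_smul_integralHodgeClassesCorrRingHom_pushforward_swapHom_lefschetzFamily_mem_corner X hTX eX eXX eT hX0 hgX hcX hgXX hgg₂ hN' hgT f hf f' Θ D hbc₁ hl₁ hl₁' h7 h7' hmX hΛL h9 h9' hΘ s₀ k hk hst i⟩ := by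
  obtain ⟨hv, hne, hsp⟩ := epsp_hyps₆₄ X hTX eX eXX eT hX0 hgX hcX hgXX hgg₂ hN' hgT f hf f' Θ D hbc₁ hl₁ hl₁' h7 h7' hmX hΛL h9 h9' hnd hθ hHg hΘ s₀ k hk hs hN hst ht hs₀
  exact exists_equiv_of_isPrimitiveIdempotent_of_forall_exists_coe_eq_sum_smul _ hv hne hsp hw hwp

include hTX eX eXX eT hX0 hgX hcX hgXX hgg₂ hN' hgT f hf f' Θ D hbc₁ hl₁ hl₁' h7 h7' hmX hΛL h9 h9' hnd hθ in
/-- **`Hg(X) = Sp` ⟹ IN EVERY DECOMPOSITION OF `H^{2g−s}(X, ℚ)` INTO INDECOMPOSABLE SUB-HODGE STRUCTURES THE MEMBERS ARE THE LEFSCHETZ SUMMANDS `L^{g−s+i} H^{s−2i}(X, ℚ)_prim`** (✔ g45-#2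
`range_toHom_…_pushforward_swapHom_…`). [cite: VoisinHodgeI2002, §7.3.1 Cor. 7.24 and §7.1.2] [cite: Lange2023AbelianVarietiesComplex, §6.3.4 Prop. 6.3.10 (p0318), §7.2.2 Thm. 7.2.4 (p0331) and §7.3.2 (1)–(3) (p0338 L3–L16)] [cite: Lam2001FirstCourse, §22 Prop. (22.1), p. 325] [cite: Kahn2020, §3.5.2 Prop. 3.45, §6.6 Thm. 6.19 and App. A Thm. A.6 (p0135)] [cite: Kunnemann1993] [cite: Milne1999LefschetzClasses, §5 p. 664 (p0026 L40–L50)] -/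
theorem exists_range_toHom_eq_lefschetzSummandSubHodgeStructure_of_mem_isPrimitiveDecomposition_endAlg_of_add_eq_of_hodgeGroup_eq_spGroup (hHg : ComplexTorus.hodgeGroup X.toIsog.Φ = ComplexTorus.spGroup X.toIsog.Φ (θ : X.toIsog.E [⋀^Fin 2]→L[ℝ] ℝ))
    (hΘ : nsDivPower X Θ gX = D • pointIntegralHodgeClass X eX) (s₀ k : ℕ) (hk : s₀ + 2 * k ≤ gX + 1) (hs : s₀ + 2 * k ≤ gX)
    (hN : lefschetzFamilyConstant gX D s₀ k ≠ 0) {t : ℕ} (hst : (s₀ + 2 * k) + t = gX + gX) (ht : t ≤ gX + gX) (hs₀ : s₀ ≤ 1) {T : Finset ((hodgeStructure X.toIsog.Φ t).endAlg)}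
    (hT : IsPrimitiveDecomposition T 1) {u : (hodgeStructure X.toIsog.Φ t).endAlg} (hu : u ∈ T) :
    ∃ i : Fin (k + 1), (endAlg.toHom u).range = ((mem_neronSeveriGroup_iff X.toIsog.Φ).1 Θ.2).lefschetzSummandSubHodgeStructure X.toIsog.Φ ((gX - (s₀ + 2 * k)) + (i : ℕ))
      (show 2 * ((gX - (s₀ + 2 * k)) + (i : ℕ)) + (s₀ + 2 * k - 2 * (i : ℕ)) = t by have := i.2; omega) := by
  have hmem : u ∈ (T : Set ((hodgeStructure X.toIsog.Φ t).endAlg)) := hu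
  rw [(isPrimitiveDecomposition_endAlg_one_iff_coe_eq_range_hodgeCornerEquiv_pushforward_swapHom_of_hodgeGroup_eq_spGroup X hTX eX eXX eT hX0 hgX hcX hgXX hgg₂ hN' hgT f hf f' Θ D hbc₁ hl₁ hl₁' h7 h7' hmX hΛL h9 h9' hnd hθ hHg hΘ s₀ k hk hs hN hst ht hs₀).1 hT] at hmem
  obtain ⟨i, rfl⟩ := hmem
  exact ⟨i, range_toHom_hodgeCornerEquiv_inv_smul_integralHodgeClassesCorrRingHom_pushforward_swapHom_lefschetzFamily X hTX eX eXX eT hX0 hgX hcX hgXX hgg₂ hN' hgT f hf f' Θ D hbc₁ hl₁ hl₁' h7 h7' hmX hΛL h9 h9' hnd hΘ s₀ k hk hs hN (j := gX - (s₀ + 2 * k)) (by omega) (by omega)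
    hst ht i (Or.inr hs₀) _⟩

end Kunnemann


/-! ## §3 Polarized complex tori of type `(d₁, …, d_g)` above the middle (towers from `θ`) -/

section Polarized

/-- The towers' codegrees for the frames `X × X`, `X × (X × X)` built from the ring frame (`g = b + 1`). [folklore] -/
private theorem tower_degrees₆₄ {gX b : ℕ} (hb : gX = b + 1) :
    (gX + gX) + gX = gX + (gX + gX) ∧ 2 * gX + 2 * 0 = 2 * gX ∧ gX + gX = 2 * gX ∧ 2 * gX + 2 * gX = 2 * (gX + gX) ∧ (gX + gX) + (gX + gX) = 2 * (gX + gX) ∧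
      gX + gX = gX + gX ∧ 2 * gX + 2 * (gX + gX) = 2 * (gX + (gX + gX)) ∧ (gX + (gX + gX)) + (gX + (gX + gX)) = 2 * (gX + (gX + gX)) ∧
      (gX + b) + 1 = gX + gX ∧ 2 * b + 2 * 1 = 2 * gX ∧ 2 * b + 2 * (gX + 1) = 2 * (gX + gX) ∧ (2 * gX + 2) + 2 * (gX + b) = 2 * (gX + (gX + gX)) ∧
      (2 * gX + 2) + 2 * b = 2 * (gX + gX) ∧ b + gX = gX + b ∧ b + (gX + 1) = gX + b + 1 ∧ 2 * gX + 2 * (gX + b + 1) = 2 * (gX + (gX + gX)) ∧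
      2 * gX + 2 * gX = 2 * (gX + gX) := by
  omega

variable (X : ComplexTorusCat) {gX gXX gT : ℕ} (hTX : gXX + gX = gT) (eX : Fin (2 * gX) ≃ X.toIsog.ι) (eXX : Fin (2 * gXX) ≃ (prodObj X X).toIsog.ι)
  (eT : Fin (2 * gT) ≃ (prodObj X (prodObj X X)).toIsog.ι) (hX0 : 2 * gX + 2 * 0 = 2 * gX) (hgX : gX + gX = 2 * gX) (hcX : 2 * gX + 2 * gX = 2 * gXX)
  (hgXX : gXX + gXX = 2 * gXX) (hgg₂ : gX + gX = gXX) (hN' : 2 * gX + 2 * gXX = 2 * gT) (hgT : gT + gT = 2 * gT)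
  (f : Fin (gX + gX) ≃ X.toIsog.ι) (hf : orientationSign X.toIsog.Φ f = 1) (f' : Fin ((gX + gX) + (gX + gX)) ≃ X.toIsog.ι ⊕ X.toIsog.ι)
  {θ : neronSeveriGroup X.toIsog.Φ} (hθ : IsRiemannForm X.toIsog.Φ (θ : X.toIsog.E [⋀^Fin 2]→L[ℝ] ℝ))
  {dd : Fin gX → ℕ} (hd : IsPolarizationType X.toIsog.Φ (θ : X.toIsog.E [⋀^Fin 2]→L[ℝ] ℝ) dd) {c₁ bc m₂ d₂ l₁ l₇ l₉ : ℕ} (hbc₁ : bc + 1 = gXX)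
  (hl₁ : l₁ + 2 * 1 = 2 * gX) (hl₁' : l₁ + 2 * c₁ = 2 * gXX) (h7 : l₇ + 2 * bc = 2 * gT) (h7' : l₇ + 2 * m₂ = 2 * gXX) (hmX : m₂ + gX = bc)
  (hΛL : m₂ + c₁ = d₂) (h9 : l₉ + 2 * d₂ = 2 * gT) (h9' : l₉ + 2 * gX = 2 * gXX)

include hθ hd in
/-- `(−1)^g d₁⋯d_g ≠ 0` for a polarization of type `(d₁, …, d_g)`. [cite: Lange2023AbelianVarietiesComplex, §3.6 Thm. 3.6.1] -/
private theorem neg_one_pow_mul_prod_ne_zero₆₄ : ((-1 : ℤ) ^ gX * ∏ j, (dd j : ℤ)) ≠ 0 :=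
  mul_ne_zero (pow_ne_zero _ (by norm_num)) (Finset.prod_ne_zero_iff.2 fun j _ ↦ Int.natCast_ne_zero.2 (hd.pos hθ j).ne')

set_option maxSynthPendingDepth 3
set_option synthInstance.maxHeartbeats 200000

include hTX eX eXX eT hX0 hgX hcX hgXX hgg₂ hN' hgT f hf f' hbc₁ hl₁ hl₁' h7 h7' hmX hΛL h9 h9' hθ hd in
/-- **ON A HODGE-GENERAL POLARIZED COMPLEX TORUS OF TYPE `(d₁, …, d_g)`: `End_Hdg(H^{2g−s}(X, ℚ)) ≅ ℚ^{⌊s/2⌋+1}` AS `ℚ`-ALGEBRAS** (`s = s₀ + 2k ≤ g`, `s₀ ≤ 1`, `s + t = 2g`). [cite: Lange2023AbelianVarietiesComplex, §3.6 Thm. 3.6.1, §6.3.4 Prop. 6.3.10 (p0318), §7.2.2 Thm. 7.2.4 (p0331) and §7.3.2 (1)–(3) (p0338 L3–L16)] [cite: Lam2001FirstCourse, §22 Prop. (22.1), p. 325] [cite: Kahn2020, §3.5.2 Prop. 3.45 and §6.6 Thm. 6.19] [cite: Kunnemann1993]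
[cite: GoodmanWallachGTM255, §5.5.1 Cor. 5.5.9 (5.54)] -/
theorem nonempty_endAlg_hodgeStructure_algEquiv_pi_of_add_eq_of_isPolarizationType_of_hodgeGroup_eq_spGroup (hHg : ComplexTorus.hodgeGroup X.toIsog.Φ = ComplexTorus.spGroup X.toIsog.Φ (θ : X.toIsog.E [⋀^Fin 2]→L[ℝ] ℝ)) (s₀ k : ℕ) (hk : s₀ + 2 * k ≤ gX + 1) (hs : s₀ + 2 * k ≤ gX) (hs₀ : s₀ ≤ 1) {t : ℕ}
    (hst : (s₀ + 2 * k) + t = gX + gX) :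
    Nonempty ((hodgeStructure X.toIsog.Φ t).endAlg ≃ₐ[ℚ] (Fin (k + 1) → ℚ)) :=
  nonempty_endAlg_hodgeStructure_algEquiv_pi_of_add_eq_of_hodgeGroup_eq_spGroup X hTX eX eXX eT hX0 hgX hcX hgXX hgg₂ hN' hgT f hf f' θ _ hbc₁ hl₁ hl₁' h7 h7' hmX hΛL h9 h9' (IsRiemannForm.exists_apply_ne_zero X.toIsog.Φ hθ) hθ hHg
    (nsDivPower_top_eq_zsmul_pointIntegralHodgeClass X eX hθ hd) s₀ k hk hs (lefschetzFamilyConstant_ne_zero (neg_one_pow_mul_prod_ne_zero₆₄ X hθ hd) s₀ k hk) hst (by omega) hs₀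

include hTX eX eXX eT hX0 hgX hcX hgXX hgg₂ hN' hgT f hf f' hbc₁ hl₁ hl₁' h7 h7' hmX hΛL h9 h9' hθ hd in
/-- **… `End_Hdg(H^{2g−s}(X, ℚ))` HAS EXACTLY `⌊s/2⌋ + 1` BLOCKS.** [cite: Lange2023AbelianVarietiesComplex, §3.6 Thm. 3.6.1, §6.3.4 Prop. 6.3.10 (p0318), §7.2.2 Thm. 7.2.4 (p0331) and §7.3.2 (1)–(3) (p0338 L3–L16)] [cite: Lam2001FirstCourse, §22 Prop. (22.1), p. 325] [cite: Kahn2020, §3.5.2 Prop. 3.45 and §6.6 Thm. 6.19] [cite: Kunnemann1993] -/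
theorem ncard_setOf_isCentrallyPrimitive_endAlg_of_add_eq_of_isPolarizationType_of_hodgeGroup_eq_spGroup (hHg : ComplexTorus.hodgeGroup X.toIsog.Φ = ComplexTorus.spGroup X.toIsog.Φ (θ : X.toIsog.E [⋀^Fin 2]→L[ℝ] ℝ)) (s₀ k : ℕ) (hk : s₀ + 2 * k ≤ gX + 1) (hs : s₀ + 2 * k ≤ gX) (hs₀ : s₀ ≤ 1) {t : ℕ}
    (hst : (s₀ + 2 * k) + t = gX + gX) :
    {u : (hodgeStructure X.toIsog.Φ t).endAlg | IsCentrallyPrimitive u}.ncard = k + 1 :=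
  ncard_setOf_isCentrallyPrimitive_endAlg_of_add_eq_of_hodgeGroup_eq_spGroup X hTX eX eXX eT hX0 hgX hcX hgXX hgg₂ hN' hgT f hf f' θ _ hbc₁ hl₁ hl₁' h7 h7' hmX hΛL h9 h9' (IsRiemannForm.exists_apply_ne_zero X.toIsog.Φ hθ) hθ hHg
    (nsDivPower_top_eq_zsmul_pointIntegralHodgeClass X eX hθ hd) s₀ k hk hs (lefschetzFamilyConstant_ne_zero (neg_one_pow_mul_prod_ne_zero₆₄ X hθ hd) s₀ k hk) hst (by omega) hs₀

include hTX eX eXX eT hX0 hgX hcX hgXX hgg₂ hN' hgT f hf f' hbc₁ hl₁ hl₁' h7 h7' hmX hΛL h9 h9' hθ hd in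
/-- **… EXACTLY `⌊s/2⌋ + 1` PRIMITIVE IDEMPOTENTS** (indecomposable direct summands `L^{g−s+i} H^{s−2i}(X, ℚ)_prim` of `H^{2g−s}(X, ℚ)`). [cite: Lange2023AbelianVarietiesComplex, §3.6 Thm. 3.6.1, §6.3.4 Prop. 6.3.10 (p0318), §7.2.2 Thm. 7.2.4 (p0331) and §7.3.2 (1)–(3) (p0338 L3–L16)] [cite: Lam2001FirstCourse, §22 Prop. (22.1), p. 325] [cite: Kahn2020, §3.5.2 Prop. 3.45 and §6.6 Thm. 6.19] [cite: Kunnemann1993] -/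
theorem ncard_setOf_isPrimitiveIdempotent_endAlg_of_add_eq_of_isPolarizationType_of_hodgeGroup_eq_spGroup (hHg : ComplexTorus.hodgeGroup X.toIsog.Φ = ComplexTorus.spGroup X.toIsog.Φ (θ : X.toIsog.E [⋀^Fin 2]→L[ℝ] ℝ)) (s₀ k : ℕ) (hk : s₀ + 2 * k ≤ gX + 1) (hs : s₀ + 2 * k ≤ gX) (hs₀ : s₀ ≤ 1) {t : ℕ}
    (hst : (s₀ + 2 * k) + t = gX + gX) :
    {u : (hodgeStructure X.toIsog.Φ t).endAlg | IsPrimitiveIdempotent u}.ncard = k + 1 :=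
  ncard_setOf_isPrimitiveIdempotent_endAlg_of_add_eq_of_hodgeGroup_eq_spGroup X hTX eX eXX eT hX0 hgX hcX hgXX hgg₂ hN' hgT f hf f' θ _ hbc₁ hl₁ hl₁' h7 h7' hmX hΛL h9 h9' (IsRiemannForm.exists_apply_ne_zero X.toIsog.Φ hθ) hθ hHg
    (nsDivPower_top_eq_zsmul_pointIntegralHodgeClass X eX hθ hd) s₀ k hk hs (lefschetzFamilyConstant_ne_zero (neg_one_pow_mul_prod_ne_zero₆₄ X hθ hd) s₀ k hk) hst (by omega) hs₀

include hTX eX eXX eT hX0 hgX hcX hgXX hgg₂ hN' hgT f hf f' hbc₁ hl₁ hl₁' h7 h7' hmX hΛL h9 h9' hθ hd in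
/-- **… AND EXACTLY `2^{⌊s/2⌋+1}` IDEMPOTENTS.** [cite: Lam2001FirstCourse, §22 Prop. (22.1) (1) and (3), p. 325] [cite: Lange2023AbelianVarietiesComplex, §3.6 Thm. 3.6.1, §6.3.4 Prop. 6.3.10 (p0318), §7.2.2 Thm. 7.2.4 (p0331) and §7.3.2 (1)–(3) (p0338 L3–L16)] [cite: Lam2001FirstCourse, §22 Prop. (22.1), p. 325] [cite: Kahn2020, §3.5.2 Prop. 3.45 and §6.6 Thm. 6.19] [cite: Kunnemann1993] -/
theorem ncard_setOf_isIdempotentElem_endAlg_of_add_eq_of_isPolarizationType_of_hodgeGroup_eq_spGroup (hHg : ComplexTorus.hodgeGroup X.toIsog.Φ = ComplexTorus.spGroup X.toIsog.Φ (θ : X.toIsog.E [⋀^Fin 2]→L[ℝ] ℝ)) (s₀ k : ℕ) (hk : s₀ + 2 * k ≤ gX + 1) (hs : s₀ + 2 * k ≤ gX) (hs₀ : s₀ ≤ 1) {t : ℕ}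
    (hst : (s₀ + 2 * k) + t = gX + gX) :
    {u : (hodgeStructure X.toIsog.Φ t).endAlg | IsIdempotentElem u}.ncard = 2 ^ (k + 1) :=
  ncard_setOf_isIdempotentElem_endAlg_of_add_eq_of_hodgeGroup_eq_spGroup X hTX eX eXX eT hX0 hgX hcX hgXX hgg₂ hN' hgT f hf f' θ _ hbc₁ hl₁ hl₁' h7 h7' hmX hΛL h9 h9' (IsRiemannForm.exists_apply_ne_zero X.toIsog.Φ hθ) hθ hHg
    (nsDivPower_top_eq_zsmul_pointIntegralHodgeClass X eX hθ hd) s₀ k hk hs (lefschetzFamilyConstant_ne_zero (neg_one_pow_mul_prod_ne_zero₆₄ X hθ hd) s₀ k hk) hst (by omega) hs₀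

include hTX eX eXX eT hX0 hgX hcX hgXX hgg₂ hN' hgT f hf f' hbc₁ hl₁ hl₁' h7 h7' hmX hΛL h9 h9' hθ hd in
/-- **ON A HODGE-GENERAL POLARIZED COMPLEX TORUS OF TYPE `(d₁, …, d_g)`: `H^{2g−s}(X, ℚ)` (`s ≤ g`) HAS EXACTLY ONE DECOMPOSITION INTO INDECOMPOSABLE SUB-`ℚ`-HODGE STRUCTURES.**
[cite: Lam2001FirstCourse, §22 Prop. (22.1) (3), p. 325] [cite: Lange2023AbelianVarietiesComplex, §3.6 Thm. 3.6.1, §6.3.4 Prop. 6.3.10 (p0318), §7.2.2 Thm. 7.2.4 (p0331) and §7.3.2 (1)–(3) (p0338 L3–L16)] [cite: Lam2001FirstCourse, §22 Prop. (22.1), p. 325] [cite: Kahn2020, §3.5.2 Prop. 3.45 and §6.6 Thm. 6.19] [cite: Kunnemann1993] -/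
theorem existsUnique_isPrimitiveDecomposition_endAlg_one_of_add_eq_of_isPolarizationType_of_hodgeGroup_eq_spGroup (hHg : ComplexTorus.hodgeGroup X.toIsog.Φ = ComplexTorus.spGroup X.toIsog.Φ (θ : X.toIsog.E [⋀^Fin 2]→L[ℝ] ℝ)) (s₀ k : ℕ) (hk : s₀ + 2 * k ≤ gX + 1) (hs : s₀ + 2 * k ≤ gX) (hs₀ : s₀ ≤ 1) {t : ℕ}
    (hst : (s₀ + 2 * k) + t = gX + gX) :
    ∃! T : Finset ((hodgeStructure X.toIsog.Φ t).endAlg), IsPrimitiveDecomposition T 1 :=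
  existsUnique_isPrimitiveDecomposition_endAlg_one_of_add_eq_of_hodgeGroup_eq_spGroup X hTX eX eXX eT hX0 hgX hcX hgXX hgg₂ hN' hgT f hf f' θ _ hbc₁ hl₁ hl₁' h7 h7' hmX hΛL h9 h9' (IsRiemannForm.exists_apply_ne_zero X.toIsog.Φ hθ) hθ hHg
    (nsDivPower_top_eq_zsmul_pointIntegralHodgeClass X eX hθ hd) s₀ k hk hs (lefschetzFamilyConstant_ne_zero (neg_one_pow_mul_prod_ne_zero₆₄ X hθ hd) s₀ k hk) hst (by omega) hs₀

include hTX eX eXX eT hX0 hgX hcX hgXX hgg₂ hN' hgT f hf f' hbc₁ hl₁ hl₁' h7 h7' hmX hΛL h9 h9' hθ hd in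
/-- **… and its members are the Lefschetz summands `L^{g−s+i} H^{s−2i}(X, ℚ)_prim`** (of the Riemann form `θ`). [cite: VoisinHodgeI2002, §7.3.1 Cor. 7.24 and §7.1.2] [cite: Lange2023AbelianVarietiesComplex, §3.6 Thm. 3.6.1, §6.3.4 Prop. 6.3.10 (p0318), §7.2.2 Thm. 7.2.4 (p0331) and §7.3.2 (1)–(3) (p0338 L3–L16)] [cite: Lam2001FirstCourse, §22 Prop. (22.1), p. 325] [cite: Kahn2020, §3.5.2 Prop. 3.45 and §6.6 Thm. 6.19] [cite: Kunnemann1993] -/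
theorem exists_range_toHom_eq_lefschetzSummandSubHodgeStructure_of_mem_isPrimitiveDecomposition_endAlg_of_add_eq_of_isPolarizationType_of_hodgeGroup_eq_spGroup (hHg : ComplexTorus.hodgeGroup X.toIsog.Φ = ComplexTorus.spGroup X.toIsog.Φ (θ : X.toIsog.E [⋀^Fin 2]→L[ℝ] ℝ)) (s₀ k : ℕ) (hk : s₀ + 2 * k ≤ gX + 1) (hs : s₀ + 2 * k ≤ gX) (hs₀ : s₀ ≤ 1) {t : ℕ}
    (hst : (s₀ + 2 * k) + t = gX + gX)
    {T : Finset ((hodgeStructure X.toIsog.Φ t).endAlg)} (hT : IsPrimitiveDecomposition T 1) {u : (hodgeStructure X.toIsog.Φ t).endAlg} (hu : u ∈ T) :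
    ∃ i : Fin (k + 1), (endAlg.toHom u).range = hθ.isNSForm.lefschetzSummandSubHodgeStructure X.toIsog.Φ ((gX - (s₀ + 2 * k)) + (i : ℕ))
      (show 2 * ((gX - (s₀ + 2 * k)) + (i : ℕ)) + (s₀ + 2 * k - 2 * (i : ℕ)) = t by have := i.2; omega) :=
  exists_range_toHom_eq_lefschetzSummandSubHodgeStructure_of_mem_isPrimitiveDecomposition_endAlg_of_add_eq_of_hodgeGroup_eq_spGroup X hTX eX eXX eT hX0 hgX hcX hgXX hgg₂ hN' hgT f hf f' θ _ hbc₁ hl₁ hl₁' h7 h7' hmX hΛL h9 h9' (IsRiemannForm.exists_apply_ne_zero X.toIsog.Φ hθ) hθ hHg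
    (nsDivPower_top_eq_zsmul_pointIntegralHodgeClass X eX hθ hd) s₀ k hk hs (lefschetzFamilyConstant_ne_zero (neg_one_pow_mul_prod_ne_zero₆₄ X hθ hd) s₀ k hk) hst (by omega) hs₀ hT hu

end Polarized

/-! ## §4 Frame-free, ALL weights `s ≤ 2g`: complex tori of positive dimension with a Riemann form `θ` and `Hg(X) = Sp(V, θ)` -/

section General

variable (X : ComplexTorusCat) {θ : neronSeveriGroup X.toIsog.Φ} (hθ : IsRiemannForm X.toIsog.Φ (θ : X.toIsog.E [⋀^Fin 2]→L[ℝ] ℝ))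
  (hHg : ComplexTorus.hodgeGroup X.toIsog.Φ = ComplexTorus.spGroup X.toIsog.Φ (θ : X.toIsog.E [⋀^Fin 2]→L[ℝ] ℝ)) (h0 : 0 < finrank ℂ X.toIsog.E)

/-- `Lʳ H^m(X, ℚ)_prim ⊂ Hᵏ(X, ℚ)` does not depend on the way `m = k − 2r` is presented. [folklore] -/
private theorem lefschetzSummandSubHodgeStructure_congr₆₄ (r : ℕ) {m m' k : ℕ} (hm : 2 * r + m = k) (hm' : 2 * r + m' = k) :
    hθ.isNSForm.lefschetzSummandSubHodgeStructure X.toIsog.Φ r hm = hθ.isNSForm.lefschetzSummandSubHodgeStructure X.toIsog.Φ r hm' := by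
  obtain rfl : m = m' := by omega
  rfl

include hθ h0 in
/-- The frames, polarization type and towers of a complex torus of positive dimension with a Riemann form, packaged (the recipe of ✔ g46-#1/#2/#4).
[cite: Lange2023AbelianVarietiesComplex, §3.6 Thm. 3.6.1 and §1.1.2] -/
private theorem exists_towers₆₄ :
    ∃ (gX gXX gT : ℕ) (_ : gXX + gX = gT) (_ : Fin (2 * gX) ≃ X.toIsog.ι) (_ : Fin (2 * gXX) ≃ (prodObj X X).toIsog.ι) (_ : Fin (2 * gT) ≃ (prodObj X (prodObj X X)).toIsog.ι)
      (_ : 2 * gX + 2 * 0 = 2 * gX) (_ : gX + gX = 2 * gX) (_ : 2 * gX + 2 * gX = 2 * gXX) (_ : gXX + gXX = 2 * gXX) (_ : gX + gX = gXX) (_ : 2 * gX + 2 * gXX = 2 * gT)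
      (_ : gT + gT = 2 * gT) (f : Fin (gX + gX) ≃ X.toIsog.ι) (_ : orientationSign X.toIsog.Φ f = 1) (_ : Fin ((gX + gX) + (gX + gX)) ≃ X.toIsog.ι ⊕ X.toIsog.ι) (dd : Fin gX → ℕ)
      (_ : IsPolarizationType X.toIsog.Φ (θ : X.toIsog.E [⋀^Fin 2]→L[ℝ] ℝ) dd) (c₁ bc m₂ d₂ l₁ l₇ l₉ : ℕ) (_ : bc + 1 = gXX) (_ : l₁ + 2 * 1 = 2 * gX) (_ : l₁ + 2 * c₁ = 2 * gXX)
      (_ : l₇ + 2 * bc = 2 * gT) (_ : l₇ + 2 * m₂ = 2 * gXX) (_ : m₂ + gX = bc) (_ : m₂ + c₁ = d₂) (_ : l₉ + 2 * d₂ = 2 * gT) (_ : l₉ + 2 * gX = 2 * gXX),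
      finrank ℂ X.toIsog.E = gX := by
  obtain ⟨gX, hgX⟩ : ∃ gX, gX = Fintype.card X.toIsog.ι / 2 := ⟨_, rfl⟩
  have hd := hθ.isPolarizationType_polarizationType.comp_cast hgX
  have hcard : Fintype.card X.toIsog.ι = 2 * gX := hd.card_eq
  let eX : Fin (2 * gX) ≃ X.toIsog.ι := (Fintype.equivFinOfCardEq hcard).symm
  have hg : finrank ℂ X.toIsog.E = gX := finrank_eq₆₄ X eX
  obtain ⟨f, hf⟩ := exists_orientationSign_eq_one X.toIsog.Φ ((finCongr (two_mul gX).symm).trans eX)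
  obtain ⟨b, hb⟩ : ∃ b, gX = b + 1 := ⟨gX - 1, by omega⟩
  obtain ⟨hTX, hX0, hgX', hcX, hgXX, hgg₂, hN', hgT, hbc₁, hl₁, hl₁', h7, h7', hmX, hΛL, h9, h9'⟩ := tower_degrees₆₄ hb
  let eXX : Fin (2 * (gX + gX)) ≃ (prodObj X X).toIsog.ι := (finCongr hcX.symm).trans (finSumFinEquiv.symm.trans (eX.sumCongr eX))
  let eT : Fin (2 * (gX + (gX + gX))) ≃ (prodObj X (prodObj X X)).toIsog.ι := (finCongr hN'.symm).trans (finSumFinEquiv.symm.trans (eX.sumCongr eXX))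
  exact ⟨gX, gX + gX, gX + (gX + gX), hTX, eX, eXX, eT, hX0, hgX', hcX, hgXX, hgg₂, hN', hgT, f, hf, finSumFinEquiv.symm.trans (f.sumCongr f), _, hd, _, _, _, _, _, _, _, hbc₁, hl₁,
    hl₁', h7, h7', hmX, hΛL, h9, h9', hg⟩

set_option maxSynthPendingDepth 3
set_option synthInstance.maxHeartbeats 200000

include hθ hHg h0 in
/-- **`Hg(X) = Sp(V, θ)` ⟹ `End_Hdg(Hˢ(X, ℚ)) ≅ ℚ × ⋯ × ℚ` (`⌊min(s, 2g−s)/2⌋ + 1` factors) AS `ℚ`-ALGEBRAS FOR EVERY WEIGHT `s ≤ 2g`** of a complex torus of positive dimension `g` with a Riemann form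
(below the middle ✔ g46-#1 §6, above §3). [cite: Lange2023AbelianVarietiesComplex, §3.6 Thm. 3.6.1, §6.3.4 Prop. 6.3.10 (p0318), §7.2.2 Thm. 7.2.4 (p0331) and §7.3.2 (1)–(3) (p0338 L3–L16)] [cite: Lam2001FirstCourse, §22 Prop. (22.1), p. 325] [cite: Kahn2020, §3.5.2 Prop. 3.45 and §6.6 Thm. 6.19] [cite: Kunnemann1993] [cite: GoodmanWallachGTM255, §5.5.1 Cor. 5.5.9 (5.54)] -/
theorem nonempty_endAlg_hodgeStructure_algEquiv_pi_of_le_two_mul_of_isRiemannForm_of_hodgeGroup_eq_spGroup {s : ℕ} (hs : s ≤ 2 * finrank ℂ X.toIsog.E) :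
    Nonempty ((hodgeStructure X.toIsog.Φ s).endAlg ≃ₐ[ℚ] (Fin (min s (2 * finrank ℂ X.toIsog.E - s) / 2 + 1) → ℚ)) := by
  obtain ⟨gX, gXX, gT, hTX, eX, eXX, eT, hX0, hgX, hcX, hgXX, hgg₂, hN', hgT, f, hf, f', dd, hd, c₁, bc, m₂, d₂, l₁, l₇, l₉, hbc₁, hl₁, hl₁', h7, h7', hmX, hΛL, h9, h9', hg⟩ :=
    exists_towers₆₄ X hθ h0
  rw [hg] at hs
  rw [hg]
  rcases Nat.lt_or_ge gX s with hlt | hle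
  · obtain ⟨s₀, k, hs₀, hsk⟩ : ∃ s₀ k, s₀ ≤ 1 ∧ 2 * gX - s = s₀ + 2 * k := ⟨(2 * gX - s) % 2, (2 * gX - s) / 2, by omega, by omega⟩
    rw [show min s (2 * gX - s) / 2 + 1 = k + 1 by rw [min_eq_right (by omega)]; omega]
    exact nonempty_endAlg_hodgeStructure_algEquiv_pi_of_add_eq_of_isPolarizationType_of_hodgeGroup_eq_spGroup X hTX eX eXX eT hX0 hgX hcX hgXX hgg₂ hN' hgT f hf f' hθ hd hbc₁ hl₁ hl₁' h7 h7' hmX hΛL h9 h9' hHg s₀ k (by omega) (by omega) hs₀ (t := s) (by omega)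
  · obtain ⟨s₀, k, hs₀, rfl⟩ : ∃ s₀ k, s₀ ≤ 1 ∧ s = s₀ + 2 * k := ⟨s % 2, s / 2, by omega, by omega⟩
    rw [show min (s₀ + 2 * k) (2 * gX - (s₀ + 2 * k)) / 2 + 1 = k + 1 by rw [min_eq_left (by omega)]; omega]
    exact nonempty_endAlg_hodgeStructure_algEquiv_pi_of_isPolarizationType_of_hodgeGroup_eq_spGroup X hTX eX eXX eT hX0 hgX hcX hgXX hgg₂ hN' hgT f hf f' hθ hd hbc₁ hl₁ hl₁' h7 h7' hmX hΛL h9 h9' hHg s₀ k (by omega) (by omega) hs₀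

include hθ hHg h0 in
/-- **`Hg(X) = Sp(V, θ)` ⟹ `End_Hdg(Hˢ(X, ℚ))` HAS EXACTLY `⌊min(s, 2g−s)/2⌋ + 1` BLOCKS FOR EVERY `s ≤ 2g`** (p08's `#blocks(End_Hdg(Hˢ(X, ℚ)))`; complex torus of positive dimension with a Riemann form).
[cite: Lange2023AbelianVarietiesComplex, §3.6 Thm. 3.6.1, §6.3.4 Prop. 6.3.10 (p0318), §7.2.2 Thm. 7.2.4 (p0331) and §7.3.2 (1)–(3) (p0338 L3–L16)] [cite: Lam2001FirstCourse, §22 Prop. (22.1), p. 325] [cite: Kahn2020, §3.5.2 Prop. 3.45 and §6.6 Thm. 6.19] [cite: Kunnemann1993] -/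
theorem ncard_setOf_isCentrallyPrimitive_endAlg_hodgeStructure_of_le_two_mul_of_isRiemannForm_of_hodgeGroup_eq_spGroup {s : ℕ} (hs : s ≤ 2 * finrank ℂ X.toIsog.E) :
    {u : (hodgeStructure X.toIsog.Φ s).endAlg | IsCentrallyPrimitive u}.ncard = min s (2 * finrank ℂ X.toIsog.E - s) / 2 + 1 := by
  obtain ⟨gX, gXX, gT, hTX, eX, eXX, eT, hX0, hgX, hcX, hgXX, hgg₂, hN', hgT, f, hf, f', dd, hd, c₁, bc, m₂, d₂, l₁, l₇, l₉, hbc₁, hl₁, hl₁', h7, h7', hmX, hΛL, h9, h9', hg⟩ :=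
    exists_towers₆₄ X hθ h0
  rw [hg] at hs
  rw [hg]
  rcases Nat.lt_or_ge gX s with hlt | hle
  · obtain ⟨s₀, k, hs₀, hsk⟩ : ∃ s₀ k, s₀ ≤ 1 ∧ 2 * gX - s = s₀ + 2 * k := ⟨(2 * gX - s) % 2, (2 * gX - s) / 2, by omega, by omega⟩
    rw [show min s (2 * gX - s) / 2 + 1 = k + 1 by rw [min_eq_right (by omega)]; omega]
    exact ncard_setOf_isCentrallyPrimitive_endAlg_of_add_eq_of_isPolarizationType_of_hodgeGroup_eq_spGroup X hTX eX eXX eT hX0 hgX hcX hgXX hgg₂ hN' hgT f hf f' hθ hd hbc₁ hl₁ hl₁' h7 h7' hmX hΛL h9 h9' hHg s₀ k (by omega) (by omega) hs₀ (t := s) (by omega)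
  · obtain ⟨s₀, k, hs₀, rfl⟩ : ∃ s₀ k, s₀ ≤ 1 ∧ s = s₀ + 2 * k := ⟨s % 2, s / 2, by omega, by omega⟩
    rw [show min (s₀ + 2 * k) (2 * gX - (s₀ + 2 * k)) / 2 + 1 = k + 1 by rw [min_eq_left (by omega)]; omega]
    exact ncard_setOf_isCentrallyPrimitive_endAlg_of_isPolarizationType_of_hodgeGroup_eq_spGroup X hTX eX eXX eT hX0 hgX hcX hgXX hgg₂ hN' hgT f hf f' hθ hd hbc₁ hl₁ hl₁' h7 h7' hmX hΛL h9 h9' hHg s₀ k (by omega) (by omega) hs₀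

include hθ hHg h0 in
/-- **`Hg(X) = Sp(V, θ)` ⟹ `End_Hdg(Hˢ(X, ℚ))` HAS EXACTLY `⌊min(s, 2g−s)/2⌋ + 1` PRIMITIVE IDEMPOTENTS FOR EVERY `s ≤ 2g`**: `Hˢ(X, ℚ)` has exactly that many indecomposable direct-summand sub-Hodge
structures (complex torus of positive dimension with a Riemann form). [cite: Lange2023AbelianVarietiesComplex, §3.6 Thm. 3.6.1, §6.3.4 Prop. 6.3.10 (p0318), §7.2.2 Thm. 7.2.4 (p0331) and §7.3.2 (1)–(3) (p0338 L3–L16)] [cite: Lam2001FirstCourse, §22 Prop. (22.1), p. 325] [cite: Kahn2020, §3.5.2 Prop. 3.45 and §6.6 Thm. 6.19] [cite: Kunnemann1993] -/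
theorem ncard_setOf_isPrimitiveIdempotent_endAlg_hodgeStructure_of_le_two_mul_of_isRiemannForm_of_hodgeGroup_eq_spGroup {s : ℕ} (hs : s ≤ 2 * finrank ℂ X.toIsog.E) :
    {u : (hodgeStructure X.toIsog.Φ s).endAlg | IsPrimitiveIdempotent u}.ncard = min s (2 * finrank ℂ X.toIsog.E - s) / 2 + 1 := by
  obtain ⟨gX, gXX, gT, hTX, eX, eXX, eT, hX0, hgX, hcX, hgXX, hgg₂, hN', hgT, f, hf, f', dd, hd, c₁, bc, m₂, d₂, l₁, l₇, l₉, hbc₁, hl₁, hl₁', h7, h7', hmX, hΛL, h9, h9', hg⟩ :=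
    exists_towers₆₄ X hθ h0
  rw [hg] at hs
  rw [hg]
  rcases Nat.lt_or_ge gX s with hlt | hle
  · obtain ⟨s₀, k, hs₀, hsk⟩ : ∃ s₀ k, s₀ ≤ 1 ∧ 2 * gX - s = s₀ + 2 * k := ⟨(2 * gX - s) % 2, (2 * gX - s) / 2, by omega, by omega⟩
    rw [show min s (2 * gX - s) / 2 + 1 = k + 1 by rw [min_eq_right (by omega)]; omega]
    exact ncard_setOf_isPrimitiveIdempotent_endAlg_of_add_eq_of_isPolarizationType_of_hodgeGroup_eq_spGroup X hTX eX eXX eT hX0 hgX hcX hgXX hgg₂ hN' hgT f hf f' hθ hd hbc₁ hl₁ hl₁' h7 h7' hmX hΛL h9 h9' hHg s₀ k (by omega) (by omega) hs₀ (t := s) (by omega)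
  · obtain ⟨s₀, k, hs₀, rfl⟩ : ∃ s₀ k, s₀ ≤ 1 ∧ s = s₀ + 2 * k := ⟨s % 2, s / 2, by omega, by omega⟩
    rw [show min (s₀ + 2 * k) (2 * gX - (s₀ + 2 * k)) / 2 + 1 = k + 1 by rw [min_eq_left (by omega)]; omega]
    exact ncard_setOf_isPrimitiveIdempotent_endAlg_of_isPolarizationType_of_hodgeGroup_eq_spGroup X hTX eX eXX eT hX0 hgX hcX hgXX hgg₂ hN' hgT f hf f' hθ hd hbc₁ hl₁ hl₁' h7 h7' hmX hΛL h9 h9' hHg s₀ k (by omega) (by omega) hs₀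

include hθ hHg h0 in
/-- **`Hg(X) = Sp(V, θ)` ⟹ `End_Hdg(Hˢ(X, ℚ))` HAS EXACTLY `2^{⌊min(s, 2g−s)/2⌋+1}` IDEMPOTENTS FOR EVERY `s ≤ 2g`** (direct-summand sub-Hodge structures of `Hˢ(X, ℚ)`; complex torus of positive
dimension with a Riemann form). [cite: Lam2001FirstCourse, §22 Prop. (22.1) (1) and (3), p. 325] [cite: Lange2023AbelianVarietiesComplex, §3.6 Thm. 3.6.1, §6.3.4 Prop. 6.3.10 (p0318), §7.2.2 Thm. 7.2.4 (p0331) and §7.3.2 (1)–(3) (p0338 L3–L16)] [cite: Lam2001FirstCourse, §22 Prop. (22.1), p. 325] [cite: Kahn2020, §3.5.2 Prop. 3.45 and §6.6 Thm. 6.19] [cite: Kunnemann1993] -/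
theorem ncard_setOf_isIdempotentElem_endAlg_hodgeStructure_of_le_two_mul_of_isRiemannForm_of_hodgeGroup_eq_spGroup {s : ℕ} (hs : s ≤ 2 * finrank ℂ X.toIsog.E) :
    {u : (hodgeStructure X.toIsog.Φ s).endAlg | IsIdempotentElem u}.ncard = 2 ^ (min s (2 * finrank ℂ X.toIsog.E - s) / 2 + 1) := by
  obtain ⟨gX, gXX, gT, hTX, eX, eXX, eT, hX0, hgX, hcX, hgXX, hgg₂, hN', hgT, f, hf, f', dd, hd, c₁, bc, m₂, d₂, l₁, l₇, l₉, hbc₁, hl₁, hl₁', h7, h7', hmX, hΛL, h9, h9', hg⟩ :=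
    exists_towers₆₄ X hθ h0
  rw [hg] at hs
  rw [hg]
  rcases Nat.lt_or_ge gX s with hlt | hle
  · obtain ⟨s₀, k, hs₀, hsk⟩ : ∃ s₀ k, s₀ ≤ 1 ∧ 2 * gX - s = s₀ + 2 * k := ⟨(2 * gX - s) % 2, (2 * gX - s) / 2, by omega, by omega⟩
    rw [show min s (2 * gX - s) / 2 + 1 = k + 1 by rw [min_eq_right (by omega)]; omega]
    exact ncard_setOf_isIdempotentElem_endAlg_of_add_eq_of_isPolarizationType_of_hodgeGroup_eq_spGroup X hTX eX eXX eT hX0 hgX hcX hgXX hgg₂ hN' hgT f hf f' hθ hd hbc₁ hl₁ hl₁' h7 h7' hmX hΛL h9 h9' hHg s₀ k (by omega) (by omega) hs₀ (t := s) (by omega)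
  · obtain ⟨s₀, k, hs₀, rfl⟩ : ∃ s₀ k, s₀ ≤ 1 ∧ s = s₀ + 2 * k := ⟨s % 2, s / 2, by omega, by omega⟩
    rw [show min (s₀ + 2 * k) (2 * gX - (s₀ + 2 * k)) / 2 + 1 = k + 1 by rw [min_eq_left (by omega)]; omega]
    exact ncard_setOf_isIdempotentElem_endAlg_of_isPolarizationType_of_hodgeGroup_eq_spGroup X hTX eX eXX eT hX0 hgX hcX hgXX hgg₂ hN' hgT f hf f' hθ hd hbc₁ hl₁ hl₁' h7 h7' hmX hΛL h9 h9' hHg s₀ k (by omega) (by omega) hs₀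

include hθ hHg h0 in
/-- **`Hg(X) = Sp(V, θ)` ⟹ FOR EVERY WEIGHT `s ≤ 2g` THE `ℚ`-HODGE STRUCTURE `Hˢ(X, ℚ)` OF A COMPLEX TORUS OF POSITIVE DIMENSION WITH A RIEMANN FORM HAS EXACTLY ONE DECOMPOSITION INTO INDECOMPOSABLE
SUB-HODGE STRUCTURES** — the rational Lefschetz decomposition (below the middle ✔ g46-#4, above §3). [cite: Lam2001FirstCourse, §22 Prop. (22.1) (3), p. 325] [cite: Lange2023AbelianVarietiesComplex, §3.6 Thm. 3.6.1, §6.3.4 Prop. 6.3.10 (p0318), §7.2.2 Thm. 7.2.4 (p0331) and §7.3.2 (1)–(3) (p0338 L3–L16)] [cite: Lam2001FirstCourse, §22 Prop. (22.1), p. 325] [cite: Kahn2020, §3.5.2 Prop. 3.45 and §6.6 Thm. 6.19] [cite: Kunnemann1993]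
[cite: Milne1999LefschetzClasses, §5 p. 664 (p0026 L40–L50)] -/
theorem existsUnique_isPrimitiveDecomposition_endAlg_hodgeStructure_one_of_le_two_mul_of_isRiemannForm_of_hodgeGroup_eq_spGroup {s : ℕ} (hs : s ≤ 2 * finrank ℂ X.toIsog.E) :
    ∃! T : Finset ((hodgeStructure X.toIsog.Φ s).endAlg), IsPrimitiveDecomposition T 1 := by
  obtain ⟨gX, gXX, gT, hTX, eX, eXX, eT, hX0, hgX, hcX, hgXX, hgg₂, hN', hgT, f, hf, f', dd, hd, c₁, bc, m₂, d₂, l₁, l₇, l₉, hbc₁, hl₁, hl₁', h7, h7', hmX, hΛL, h9, h9', hg⟩ :=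
    exists_towers₆₄ X hθ h0
  rw [hg] at hs
  rcases Nat.lt_or_ge gX s with hlt | hle
  · obtain ⟨s₀, k, hs₀, hsk⟩ : ∃ s₀ k, s₀ ≤ 1 ∧ 2 * gX - s = s₀ + 2 * k := ⟨(2 * gX - s) % 2, (2 * gX - s) / 2, by omega, by omega⟩
    exact existsUnique_isPrimitiveDecomposition_endAlg_one_of_add_eq_of_isPolarizationType_of_hodgeGroup_eq_spGroup X hTX eX eXX eT hX0 hgX hcX hgXX hgg₂ hN' hgT f hf f' hθ hd hbc₁ hl₁ hl₁' h7 h7' hmX hΛL h9 h9' hHg s₀ k (by omega) (by omega) hs₀ (t := s) (by omega)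
  · obtain ⟨s₀, k, hs₀, rfl⟩ : ∃ s₀ k, s₀ ≤ 1 ∧ s = s₀ + 2 * k := ⟨s % 2, s / 2, by omega, by omega⟩
    exact existsUnique_isPrimitiveDecomposition_endAlg_one_of_isPolarizationType_of_hodgeGroup_eq_spGroup X hTX eX eXX eT hX0 hgX hcX hgXX hgg₂ hN' hgT f hf f' hθ hd hbc₁ hl₁ hl₁' h7 h7' hmX hΛL h9 h9' hHg s₀ k (by omega) (by omega) hs₀

include hθ hHg h0 in
/-- **`Hg(X) = Sp(V, θ)` ⟹ FOR EVERY `s ≤ 2g`, THE MEMBERS OF ANY DECOMPOSITION OF `Hˢ(X, ℚ)` INTO INDECOMPOSABLE SUB-`ℚ`-HODGE STRUCTURES ARE LEFSCHETZ SUMMANDS `Lʳ H^{s−2r}(X, ℚ)_prim` OF `θ`**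
(complex torus of positive dimension with a Riemann form; below the middle ✔ g46-#4, above §3). [cite: VoisinHodgeI2002, §7.3.1 Cor. 7.24 and §7.1.2] [cite: Lange2023AbelianVarietiesComplex, §3.6 Thm. 3.6.1, §6.3.4 Prop. 6.3.10 (p0318), §7.2.2 Thm. 7.2.4 (p0331) and §7.3.2 (1)–(3) (p0338 L3–L16)] [cite: Lam2001FirstCourse, §22 Prop. (22.1), p. 325] [cite: Kahn2020, §3.5.2 Prop. 3.45 and §6.6 Thm. 6.19] [cite: Kunnemann1993] [cite: Milne1999LefschetzClasses, §5 p. 664 (p0026 L40–L50)] -/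
theorem exists_range_toHom_eq_lefschetzSummandSubHodgeStructure_of_mem_isPrimitiveDecomposition_endAlg_of_le_two_mul_of_isRiemannForm_of_hodgeGroup_eq_spGroup {s : ℕ}
    (hs : s ≤ 2 * finrank ℂ X.toIsog.E) {T : Finset ((hodgeStructure X.toIsog.Φ s).endAlg)} (hT : IsPrimitiveDecomposition T 1) {u : (hodgeStructure X.toIsog.Φ s).endAlg} (hu : u ∈ T) :
    ∃ (r : ℕ) (hr : 2 * r ≤ s), (endAlg.toHom u).range = hθ.isNSForm.lefschetzSummandSubHodgeStructure X.toIsog.Φ r (Nat.add_sub_cancel' hr) := by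
  obtain ⟨gX, gXX, gT, hTX, eX, eXX, eT, hX0, hgX, hcX, hgXX, hgg₂, hN', hgT, f, hf, f', dd, hd, c₁, bc, m₂, d₂, l₁, l₇, l₉, hbc₁, hl₁, hl₁', h7, h7', hmX, hΛL, h9, h9', hg⟩ :=
    exists_towers₆₄ X hθ h0
  rw [hg] at hs
  rcases Nat.lt_or_ge gX s with hlt | hle
  · obtain ⟨s₀, k, hs₀, hsk⟩ : ∃ s₀ k, s₀ ≤ 1 ∧ 2 * gX - s = s₀ + 2 * k := ⟨(2 * gX - s) % 2, (2 * gX - s) / 2, by omega, by omega⟩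
    obtain ⟨i, hi⟩ := exists_range_toHom_eq_lefschetzSummandSubHodgeStructure_of_mem_isPrimitiveDecomposition_endAlg_of_add_eq_of_isPolarizationType_of_hodgeGroup_eq_spGroup X hTX eX eXX eT hX0 hgX hcX hgXX hgg₂ hN' hgT f hf f' hθ hd hbc₁ hl₁ hl₁' h7 h7' hmX hΛL h9 h9' hHg s₀ k
      (by omega) (by omega) hs₀ (t := s) (by omega) hT hu
    exact ⟨gX - (s₀ + 2 * k) + i, by have := i.2; omega, hi.trans (lefschetzSummandSubHodgeStructure_congr₆₄ X hθ _ _ _)⟩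
  · exact exists_range_toHom_eq_lefschetzSummandSubHodgeStructure_of_mem_isPrimitiveDecomposition_endAlg_of_isRiemannForm_of_hodgeGroup_eq_spGroup X hθ hHg h0 (by omega) hT hu

end General


end ComplexTorusCat

end Literature.AlgebraicGeometry.HodgeTheory

end
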